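import Summits.BirchSwinnertonDyer.BirchSwinnertonDyer.Theses.SignedBaseChange
import Literature.NumberTheory.EllipticCurves.BurungaleCastellaSkinner2025.BDPMainConjecture
import Literature.NumberTheory.EllipticCurves.BurungaleCastellaSkinner2025.ProductDivisibilitiesIntegralityProofs
import Literature.NumberTheory.EllipticCurves.YanZhu2026.GreenbergMainTheoremsAnyRoot
import Literature.NumberTheory.EllipticCurves.SupersingularDensitySerreFrobeniusProofs
import Literature.NumberTheory.EllipticCurves.HeegnerPointsKolyvaginTorsionProofs
import Literature.NumberTheory.EllipticCurves.TwoVariableAnticyclotomicControl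
import Summits.BirchSwinnertonDyer.BirchSwinnertonDyer.Theorems.SignedBaseChangeAnticyclotomicEisensteinDivisibilitySpecializationS2
import Summits.BirchSwinnertonDyer.BirchSwinnertonDyer.Theorems.SignedBaseChangeAnticyclotomicEisensteinDivisibilitySpecializationHerbrand
import Summits.BirchSwinnertonDyer.BirchSwinnertonDyer.Theorems.SignedBaseChangeAnticyclotomicEisensteinDivisibilitySpecializationLength
import Summits.BirchSwinnertonDyer.BirchSwinnertonDyer.Theorems.SignedBaseChangeAnticyclotomicEisensteinDivisibilityXGrTwoModuleFinite
import Summits.BirchSwinnertonDyer.BirchSwinnertonDyer.Theorems.SignedBaseChangeAnticyclotomicEisensteinDivisibilityExactControlDuality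
import Summits.BirchSwinnertonDyer.BirchSwinnertonDyer.Theorems.SignedBaseChangeAnticyclotomicEisensteinDivisibilityExactControlDescent
import Summits.BirchSwinnertonDyer.BirchSwinnertonDyer.Theorems.SignedBaseChangeAnticyclotomicEisensteinDivisibilityControl
import Summits.BirchSwinnertonDyer.BirchSwinnertonDyer.Theorems.SignedBaseChangeTwoVariableEulerSystemDivisibilityOrdinary
import Summits.BirchSwinnertonDyer.BirchSwinnertonDyer.Theorems.SignedBaseChangeAnticyclotomicEisensteinDivisibilityAwayDiscrepancyHeegner
import Summits.BirchSwinnertonDyer.BirchSwinnertonDyer.Theorems.SignedBaseChangeAnticyclotomicEisensteinDivisibilityOfFactsRefereed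
import Summits.BirchSwinnertonDyer.BirchSwinnertonDyer.Theorems.SignedBaseChangeAnticyclotomicEisensteinDivisibilityXAcTorsionOfCCSS
import Summits.BirchSwinnertonDyer.BirchSwinnertonDyer.Theorems.UniversalToricDescentBDPFrameCrossPeriodRigidity
import Literature.NumberTheory.EllipticCurves.UnrIntegersUnits
import Literature.NumberTheory.EllipticCurves.CastellaGrossiSkinner2025.GreenbergAnticyclotomicMainConjectureProofs
import Literature.NumberTheory.EllipticCurves.CastellaHsuKunduLeeLiu2025.HeegnerPointMainConjectureSupersingularBDP
import Literature.NumberTheory.EllipticCurves.AnticyclotomicSignedMainConjectureTransfer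
import Literature.NumberTheory.EllipticCurves.AnticyclotomicSignedHeegnerClassesAnyClassNumber
import Literature.NumberTheory.EllipticCurves.NonEisensteinPrimeOfSurjective
import Literature.NumberTheory.EllipticCurves.PAdicGrossZagierConstantTermProofs
import Summits.BirchSwinnertonDyer.BirchSwinnertonDyer.Theorems.SignedBaseChangeAnticyclotomicEisensteinDivisibilityFrameConcordance
import Summits.BirchSwinnertonDyer.Rank1Residual.X11b.UnrSeriesIdealDescent
import HarnessLib

/-! # Skeleton line `ratlift` ("rational lift") v5.4 for the crux `TwoVariableEulerSystemDivisibility`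
(stmt-BirchSwinnertonDyer-20728, the Euler-system child of K1″ `TwistPairGreenbergProductDivisibilityCanonical`, route SignedBaseChange rev 22;
birth skeleton by ideator seat bsd-idea-14 g1, v3 by g4, v4 by g5 (2026-08-28), **v5 by g25 (2026-08-29) = the VARIANT-N RE-CUT OF RECORD** (v5.1, same day: header/docstring
correction only — the stubs and every declaration are byte-identical with v5 e14c84694a375c38; **v5.2 by g28 (2026-08-29)**: the four STUBS and
every v5.1 declaration byte-identical, PLUS one documentation section «HOW on CELL A from an INTEGRAL typing of CHKLL25 Cor. 7.2» — two SHAPE section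
hypotheses (`variable`s, nothing defined or asserted) and the kernel glue `howardIntegralSS_cellA_of_cor72IntegralEulerHalf` / `…_of_cor72IntegralEquality` (frame concordance
p634869 + descent `X11b.unrSeries_mem_span_singleton_of_map_mem`), five imports added for it, and the docstring erratum of g27 on the shared stub TS1∣;
**v5.3 by g31 (2026-08-29) = TWO PURE-CITE DISCHARGES after the typer row (xiv) `bsd-ssimc-ty-acsignedGeneral` landed p739631** (Literature
`CastellaHsuKunduLeeLiu2025.prop25_XAc_isTorsion` = CHKLL25 Prop. 2.5, supersingular branch, and `…thm71_cor72_isTorsion_charIdeal_map_eq` = Thm. 7.1 /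
Cor. 7.2 INTEGRAL at `N⁻ = 1`, both statement-only named facts, appended to `HeegnerPointMainConjectureSupersingularBDP.lean`): the cite stub gains
conjuncts (5), (6) (projections `cite_prop25`, `cite_cor72eq`); the shared PRE stub TS1∣ `stub_xAcTorsionSS_classDvd` is DELETED — its byte-exact text is
now the THEOREM `xAcTorsionSS_classDvd_closed` (from (5); (h0) discharged from `Surj` by Gross 1991 §2; the binder `p ∣ h_K` unused — Prop. 2.5 prints no
class-number hypothesis); HOW on CELL A is the THEOREM `howardIntegralSS_cellA_closed` (from (6) through the v5.2 glue); the stubs HOW and F1 and every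
other v5.2 declaration are byte-identical.  REGISTERED STUBS v5.3 (3): `stub_namedFactsSS` (cite-only, 6 conjuncts) · `stub_howardIntegralSS` (content;
cell A now PURE-CITE, cell B = Lei–Zhao 2023 Thm. A typing want #5 pending, residual CONTENT) · `stub_ratEulerSystemSS` (research);
**v5.4 by g32 (2026-08-29) = HOW ON CELL C ⊋ A ∪ B, PURE-CITE FROM A REFEREED FACT ALREADY IN THE TREE**: the cite stub gains conjunct (7)
`AcSigned.castellaWan2024_thmA5_thm68_bdp_mem_charIdeal` (Castella–Wan, Math. Ann. 389 (2024): Thm. A.5 + Thm. 6.8 «the same result holds for the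
opposite divisibilities» — the INTEGRAL inclusion `L_p^BDP ∈ char_Λ(X^{rel,str})·Λ^ur` at `N⁻ = 1`, `N` square-free, `p > 3`, in `AcSigned.Setting`
(`p ∤ h_K`); typed 2026-08-28 by the seat `bsd-wall-utd-ty1` in `Literature/…/AnticyclotomicSignedMainConjectureTransfer.lean` and never consumed by this
line before), projection `cite_cwA5T68`; NEW section `CellC`: ONE kernel glue `howardIntegralSS_on_of_cwEulerHalfOn` from the Castella–Wan-currency Euler
half on an ARBITRARY cell predicate `Extra` to HOW's text on that cell (frame concordance p634869 + descent, exactly as cell A) with its corollary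
`howardIntegralSS_of_cwEulerHalfOn_univ` (HOW's EXACT text when the cell is everything), the displayed SHAPE of the same composite fact over
`AcSigned.Setting₀` (ALL class numbers — Castella–Wan's journal text carries NO class-number hypothesis: MS p. 18 L60–62 «δ = 0 when the class number of
`K` is coprime to `p`», p. 25 L23–30, proof of Thm. 6.11 p. 33; typing want #6: ONE statement-only def, no new carriers) with its consequence
`howardIntegralSS_sqfree_of_cwA5T68AnyClassNumber` (HOW on {`N` square-free}, all `h_K`, CONDITIONAL on that shape), and — outside the section —
`howardIntegralSS_cellC_closed` (HOW on cell C = {`p ∤ h_K`} ∩ {`N` square-free}: PURE-CITE from (7); cell A = CHKLL25 Cor. 7.2 and cell B = Lei–Zhao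
2023 Thm. A — typing want #5, WITHDRAWN — are SUBSETS of cell C).  RESIDUAL of HOW after v5.4: {`p ∣ h_K`} ∩ {`N` square-free} (refereed print, untyped:
want #6) ∪ {`N` not square-free} (no print; but Castella–Wan's proof of Thm. A.5 uses «`N` squarefree» ONLY through [Edi97, Prop. 2.1] ⟹
`G_ℚ ↠ Aut(E[p])`, MS p. 36 L22–27 + footnote 5 — a standing binder `Surj` of the crux).  The stubs HOW and F1 and every other v5.3 declaration are
byte-identical (the cite stub's statement gains conjunct (7); `cite_cor72eq`'s projection path gains `.1`; docstrings of the cite stub and of HOW updated);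
REGISTERED STUBS v5.4 (3): `stub_namedFactsSS` (cite-only, 7 conjuncts) · `stub_howardIntegralSS` · `stub_ratEulerSystemSS`)
(director-bsd (390) «RESTUB SHAPE OF RECORD»; model: the LEAD's `Cruxes/AnticyclotomicEisensteinDivisibility/Lines/admdef.lean` v5):
every PRINT fact the line consumes now enters BY NAME as a conjunct of ONE cite stub `stub_namedFactsSS` [CITE-ONLY], the MIXED stubs of v4 are
SPLIT into cite conjuncts + one named content stub each + an in-file `…_closed` theorem, and the composition `TwoVariableEulerSystemDivisibility_of`
(kernel-checked, no `sorry`, concludes the crux BY NAME) consumes the `_closed` theorems. Nothing about BSD is proved here; no summit statement is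
proved by this file.

TOKENS (390), per v4 stub:  ORD `stub_ordSliceES` ⟶ **PURE-CITE** (conjunct (1) = YZ26 Thm 4.2 / 4.7-guarded / 3.3; `ordSliceES_closed` =
tree `SignedBaseChangeEsDivOrdinary.esChild_of_goodOrd`, p552655) · TS1 `stub_xAcTorsionSS` ⟶ **MIXED → `stub_xAcTorsionSS_classDvd`** (conjuncts (2)
LV19 Thm 1.4 + (3) CW24 proof-of-Thm-6.8 `TransferInputs` close `p ∤ h_K` through tree `SignedBaseChangeAcDivOfFactsRefereed.xAcTorsionSS_of_refereed_of_classDvd`;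
the residue `p ∣ h_K` was the PRE stub SHARED byte-identically with the LEAD's `AdmdefLine.stub_xAcTorsionSS_classDvd` / `Bdpline.…` on crux 20727 —
staffed once; `xAcTorsionSS_closed`) ⟶ **v5.3: PURE-CITE** (conjunct (5) CHKLL25 Prop. 2.5 closes the residue, indeed all of TS1, as typed:
`xAcTorsionSS_classDvd_closed`; no TS1 stub remains in this line) · MU0 `stub_xAcMuZeroSS` ⟶ **MIXED → `stub_howardIntegralSS`** (conjunct (4) BCS25 Prop 4.2.2 = Hsieh Thm B
`μ(L_p^BDP) = 0`, refereed, GOOD reduction; content = HOW, the INTEGRAL Howard / ±-Heegner-point Kolyvagin-system inclusion `L_p^BDP ∈ ch_Λ(X_ac)·R₀⟦T⟧`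
in SOME BDP frame — in print only as the unrefereed CCSS18 Thm 5.7 + Lemma 5.5 (`howardIntegralSS_of_CCSS18`, PROVED below modulo that PRE binder) and,
in the TREE's refereed typings only RATIONALLY (CW24 Thm 6.8 ∘ BLV26 Thm A, CHKLL25 Thm 7.1: `_rat` — although CHKLL25 Cor 7.2 PRINTS the integral
equality on its cell: typing want flagged); `xAcMuZeroSS_closed` = HOW + (4) + INTEGRAL CROSS-PERIOD RIGIDITY
(tree `UniversalToricDescentTwinSplit.span_singleton_eq_of_isBDPLFunction`, any periods) + a principal generator of `ch_Λ(X_ac)` (`charIdeal_isPrincipal_holds`)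
+ descent of unit content along the structure map `j : ℤ_p → R₀` (`R₀` is local: `isLocalRing_unrIntegers`, PROVED below), all kernel-checked here) ·
LCD `stub_localConditionsDescendSS` ⟶ PROVED in v4 (renamed `localConditionsDescendSS`; not a stub) · F1 `stub_ratEulerSystemSS` ⟶ **CONTENT** (research,
load-bearing, unchanged).  REGISTERED STUBS v5 (4): `stub_namedFactsSS` (cite-only) · `stub_xAcTorsionSS_classDvd` (PRE, shared) · `stub_howardIntegralSS`
(content, PRE-claimed) · `stub_ratEulerSystemSS` (research); **v5.3 (3)**: `stub_namedFactsSS` · `stub_howardIntegralSS` · `stub_ratEulerSystemSS`.  DIRECTION NOTE (v5.1 corrects v5's header, which wrongly said "HOW ⟹ the LEAD's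
rational S1 on crux 20727"): HOW is the EULER-SYSTEM half `(L_p^BDP) ⊆ ch_Λ(X_ac)·Λ^ur` (Selmer bounded above; Heegner-point Kolyvagin systems); the
LEAD's S1 on crux 20727 (`AnticyclotomicEisensteinDivisibility`) is the OPPOSITE, EISENSTEIN half `p^k · ch_Λ(X_ac) ⊆ (L_p^BDP)`; the two cruxes share
binders, objects, the frame currency and the torsion stub TS1∣ — NOT content; together (at `k = 0`) they are the BDP main conjecture at supersingular `p`
(CHKLL25 Cor 7.2 prints the equality on its cell).  The typed CCSS18 `_OPEN` claim gives TS1 + HOW (all cells), i.e. it reduces 20728 to F1; it does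
not touch 20727's S1.

THE CRUX. For every good `p ≥ 5` with `Surj`, every admissible `(K, v, v̄, κ₁, κ₂, γ₁, γ₂, f)` and every Katz/Greenberg frame `(LK, G)`: the INTEGRAL
two-variable "Euler-system" inclusion `(G) ⊆ ch_{Λ_K}(X_Gr(E/K̃_∞)) · 𝒪_{ℂ_p}⟦T₁,T₂⟧` (structure map `J`), i.e. `ch(X_Gr₂) ∣ 𝓛_p^Gr(f/K)` integrally.

THE MOVE (lens `complete`; unchanged since v1): ordinary `p` = refereed print (ORD). Supersingular `p` (`a_p = 0`): NO Λ-integral two-variable Euler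
system is in print, so the line TRANSFERS the crux to C⁺ = F1 `stub_ratEulerSystemSS`: `∃ a, (p^a · G) ⊆ ch(X_Gr₂)^J` (exactly the `μ`-part forgotten)
and LIFTS integrality from the anticyclotomic line `T₁ = 0`, where `μ` is accessible without any two-variable Euler system: TS1 (`X_ac` is `Λ`-torsion),
MU0 (`ch_Λ(X_ac)` has a unit-content member — now DERIVED from HOW + Hsieh), LCD (local conditions descend — PROVED), exact control `X_Gr₂/T₁ ≅ X_ac`
(DERIVED, `controlExactSS`), Herbrand specialisation in divisibility form (`charIdeal_quotSMulTop_le_map`, PROVED) ⟹ `μ(c⁻) = 0` for the generator `c` of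
`ch(X_Gr₂)^J` ⟹ the `p`-power of F1 cancels (`le_span_of_span_natCast_pow_mul_le_of_hasUnitContent_minus`, tree) ⟹ the crux.

WHY EASIER (transfer C ⟸ C⁺ ∧ arithmetic inputs): C⁺ forgets exactly the `μ`-part, which is where two-variable Beilinson–Flach/signed arguments at
`a_p = 0` lose integrality; the `μ`-information is re-supplied on the anticyclotomic line by Heegner points (integral Kolyvagin systems: HOW) and
Hsieh/BCS `μ(L^BDP) = 0` (cite (4)), and transported up by the Herbrand specialisation. Dead lines avoided: no tame companion Euler system / (St)₂
carriers, no two-variable Eisenstein inclusion (R3's `GreenbergLowerHalfConj912`, which alone closes the parent), no `L`-function frame currency in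
the crux-facing statements (HOW's frame is ∃-quantified and rigid: `span_singleton_eq_of_isBDPLFunction`).
-/

-- D-0017: single-problem summit, the namespace repeats the problem name by design.
set_option linter.dupNamespace false
set_option autoImplicit false

noncomputable section

open scoped Classical

namespace Summit.BirchSwinnertonDyer.BirchSwinnertonDyer.Cruxes.TwoVariableEulerSystemDivisibility.Ratlift

open Summit.BirchSwinnertonDyer.BirchSwinnertonDyer.Theses.SignedBaseChange
open Literature.NumberTheory.EllipticCurves Literature.NumberTheory.EllipticCurves.Module
open Summit.BirchSwinnertonDyer.BirchSwinnertonDyer.Theorems.SignedBaseChangeAcDivSpecialization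

/-! ## The stubs (3): the cite stub · HOW (content, PRE-claimed; cell A closed below) · F1 (research) — and the former TS1∣ stub, now a closed theorem -/

/-- cite stub `stub_namedFactsSS` [CITE-ONLY — never a proof target, never benched, never counted] (VARIANT-N shape of record,
director-bsd (390); PRINT): the conjunction, BY NAME, of the typed Literature named facts the composition consumes — (1) YZ26 Thm 4.2 (2) /
Thm 4.7 (guarded) / Thm 3.3 (the ORDINARY slice; = conjunct (1) of the LEAD's `AdmdefLine.stub_namedFactsSS` on crux 20727), (2) LV19 Thm 1.4
(`X^ε` of `Λ`-rank one; = LEAD's (2)), (3) CW24, the inputs of the proof of Thm 6.8 (`TransferInputs`; = LEAD's (3)), (4) BCS25 Prop 4.2.2 (the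
`L_p^BDP` half, `μ(L_p^BDP) = 0`, source Hsieh 2014 Thm B; GOOD reduction, no ordinarity; = LEAD's (7)), and — NEW in v5.3, landed by the typer row (xiv)
p739631 (2026-08-29) — (5) CHKLL25 Prop. 2.5, supersingular branch (`X_q = Sel_q(K_∞,W)^∨` is `Λ`-torsion under (Heeg)+(spl)+(h0); NO class-number /
square-free hypothesis printed, arXiv:2308.10474v2 p0008 L17–L28; flag `CHKLL-prop25-adaptation`) and (6) CHKLL25 Thm. 7.1 / Cor. 7.2 INTEGRAL at `N⁻ = 1`
(= Castella–Wan 5.2 in full on cell A: `X_ac` torsion ∧ `char_Λ(X_ac)·R₀⟦T⟧ = (L)` in a Castella–Wan frame along every compatible `j`; p0029 L28–L42; flag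
`CHKLL-cor72-via-CW24-6.8`), and — NEW in v5.4 (g32) — (7) Castella–Wan 2024 Thm. A.5 + Thm. 6.8 «opposite divisibilities» composed (Math. Ann. 389;
authors' MS pp. 29–31, 35–36): at `N⁻ = 1`, `N` square-free, `p > 3`, in `AcSigned.Setting` (`p ∤ h_K`), `Sel^{str,rel}` and `X^{rel,str}` are `Λ`-torsion and
`L_p^BDP ∈ char_Λ(X^{rel,str})·R₀⟦T⟧` in a Castella–Wan frame along every compatible `j` (typed 2026-08-28, `AnticyclotomicSignedMainConjectureTransfer.lean`;
flag `composite-A5-68`).  All seven refereed / PUBLISHED; none has a `_holds` in the tree; NO PRE claim is a conjunct (the PRE-claimed statement is the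
separate stub HOW).  Token (390): PURE-CITE.
[cite: YanZhu2024MainConjNonCM, Thm. 4.2 (2), 4.7, 3.3] [cite: LongoVigni2019, Thm. 1.4] [cite: CastellaWan2023, proof of Thm. 6.8]
[cite: BurungaleCastellaSkinner2025, Prop. 4.2.2] [cite: Hsieh2014, Thm. B] [cite: CastellaEtAl2025, Prop. 2.5 (arXiv:2308.10474v2 p0008 L17–L28)]
[cite: CastellaEtAl2025, Thm. 7.1 and Cor. 7.2 (arXiv:2308.10474v2 p0029 L28–L42)]
[cite: CastellaWan2023, Thm. A.5 (MS pp. 35–36), Thm. 6.8 (MS pp. 29–31), proof of Thm. 6.9 (MS p. 31)] -/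
theorem stub_namedFactsSS :
    (Literature.NumberTheory.EllipticCurves.YanZhu2026.thm42_XGr₂_isTorsion_charIdeal_le_greenbergAnyRoot ∧
      Literature.NumberTheory.EllipticCurves.YanZhu2026.thm47_ord_localised_iff_greenbergAnyRoot_localised_guarded ∧
      Literature.NumberTheory.EllipticCurves.YanZhu2026.thm33_exists_isHidaRankinLFunction) ∧
    (∀ (W : WeierstrassCurve ℚ) [W.IsGloballyMinimal] (K : Type) [Field K] [NumberField K] (p : ℕ) [Fact p.Prime]
      (κ : Literature.NumberTheory.EllipticCurves.ZpExtension K p) (𝔭 𝔭' : IsDedekindDomain.HeightOneSpectrum (NumberField.RingOfIntegers K)),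
      Literature.NumberTheory.EllipticCurves.AcSigned.longoVigni2019_thm14_signedSelmerDual_rank_one W K p κ 𝔭 𝔭') ∧
    (∀ (N : ℕ) [NeZero N] (W : WeierstrassCurve ℚ) [W.IsGloballyMinimal] (K : Type) [Field K] [NumberField K] (p : ℕ) [Fact p.Prime]
      (κ : Literature.NumberTheory.EllipticCurves.ZpExtension K p) (𝔭 𝔭' : IsDedekindDomain.HeightOneSpectrum (NumberField.RingOfIntegers K)),
      Literature.NumberTheory.EllipticCurves.AcSigned.castellaWan2024_proofThm68_transferInputs N W K p κ 𝔭 𝔭') ∧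
    Literature.NumberTheory.EllipticCurves.BurungaleCastellaSkinner2025.prop422_exists_isBDPLFunction_mu_eq_zero ∧
    Literature.NumberTheory.EllipticCurves.CastellaHsuKunduLeeLiu2025.prop25_XAc_isTorsion ∧
    Literature.NumberTheory.EllipticCurves.CastellaHsuKunduLeeLiu2025.thm71_cor72_isTorsion_charIdeal_map_eq ∧
    (∀ (N : ℕ) [NeZero N] (W : WeierstrassCurve ℚ) [W.IsGloballyMinimal] (K : Type) [Field K] [NumberField K] (p : ℕ) [Fact p.Prime]
      (κ : Literature.NumberTheory.EllipticCurves.ZpExtension K p) (𝔭 𝔭' : IsDedekindDomain.HeightOneSpectrum (NumberField.RingOfIntegers K)),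
      Literature.NumberTheory.EllipticCurves.AcSigned.castellaWan2024_thmA5_thm68_bdp_mem_charIdeal N W K p κ 𝔭 𝔭') := by
  sorry

/-- conjunct (1): YZ26 Thm 4.2 (2) / 4.7 (guarded) / 3.3 (projection of the cite stub). -/
theorem cite_yz :
    Literature.NumberTheory.EllipticCurves.YanZhu2026.thm42_XGr₂_isTorsion_charIdeal_le_greenbergAnyRoot ∧
      Literature.NumberTheory.EllipticCurves.YanZhu2026.thm47_ord_localised_iff_greenbergAnyRoot_localised_guarded ∧
      Literature.NumberTheory.EllipticCurves.YanZhu2026.thm33_exists_isHidaRankinLFunction :=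
  stub_namedFactsSS.1

/-- conjunct (2): LV19 Thm 1.4 (projection of the cite stub). -/
theorem cite_lv14 : ∀ (W : WeierstrassCurve ℚ) [W.IsGloballyMinimal] (K : Type) [Field K] [NumberField K] (p : ℕ) [Fact p.Prime]
      (κ : Literature.NumberTheory.EllipticCurves.ZpExtension K p) (𝔭 𝔭' : IsDedekindDomain.HeightOneSpectrum (NumberField.RingOfIntegers K)),
      Literature.NumberTheory.EllipticCurves.AcSigned.longoVigni2019_thm14_signedSelmerDual_rank_one W K p κ 𝔭 𝔭' :=
  stub_namedFactsSS.2.1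

/-- conjunct (3): CW24, the inputs of the proof of Thm 6.8 (projection of the cite stub). -/
theorem cite_cwInputs : ∀ (N : ℕ) [NeZero N] (W : WeierstrassCurve ℚ) [W.IsGloballyMinimal] (K : Type) [Field K] [NumberField K] (p : ℕ) [Fact p.Prime]
      (κ : Literature.NumberTheory.EllipticCurves.ZpExtension K p) (𝔭 𝔭' : IsDedekindDomain.HeightOneSpectrum (NumberField.RingOfIntegers K)),
      Literature.NumberTheory.EllipticCurves.AcSigned.castellaWan2024_proofThm68_transferInputs N W K p κ 𝔭 𝔭' :=
  stub_namedFactsSS.2.2.1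

/-- conjunct (4): BCS25 Prop 4.2.2, `μ(L_p^BDP) = 0` (projection of the cite stub). -/
theorem cite_prop422 : Literature.NumberTheory.EllipticCurves.BurungaleCastellaSkinner2025.prop422_exists_isBDPLFunction_mu_eq_zero :=
  stub_namedFactsSS.2.2.2.1

/-- conjunct (5): CHKLL25 Prop. 2.5, supersingular branch (projection of the cite stub; NEW in v5.3). -/
theorem cite_prop25 : Literature.NumberTheory.EllipticCurves.CastellaHsuKunduLeeLiu2025.prop25_XAc_isTorsion :=
  stub_namedFactsSS.2.2.2.2.1

/-- conjunct (6): CHKLL25 Thm. 7.1 / Cor. 7.2, INTEGRAL form at `N⁻ = 1` (projection of the cite stub; NEW in v5.3). -/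
theorem cite_cor72eq : Literature.NumberTheory.EllipticCurves.CastellaHsuKunduLeeLiu2025.thm71_cor72_isTorsion_charIdeal_map_eq :=
  stub_namedFactsSS.2.2.2.2.2.1

/-- conjunct (7): Castella–Wan 2024 Thm. A.5 + Thm. 6.8 «opposite divisibilities», INTEGRAL Euler-system half on the BDP side (projection of the cite
stub; NEW in v5.4). [cite: CastellaWan2023, Thm. A.5 (MS pp. 35–36), Thm. 6.8 (MS pp. 29–31)] -/
theorem cite_cwA5T68 : ∀ (N : ℕ) [NeZero N] (W : WeierstrassCurve ℚ) [W.IsGloballyMinimal] (K : Type) [Field K] [NumberField K] (p : ℕ) [Fact p.Prime]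
      (κ : Literature.NumberTheory.EllipticCurves.ZpExtension K p) (𝔭 𝔭' : IsDedekindDomain.HeightOneSpectrum (NumberField.RingOfIntegers K)),
      Literature.NumberTheory.EllipticCurves.AcSigned.castellaWan2024_thmA5_thm68_bdp_mem_charIdeal N W K p κ 𝔭 𝔭' :=
  stub_namedFactsSS.2.2.2.2.2.2

/-- **TS1∣ closed (v5.3: PURE-CITE; the former shared PRE stub `stub_xAcTorsionSS_classDvd`, text byte-identical with
`AdmdefLine.stub_xAcTorsionSS_classDvd` on crux 20727)**: **`X_ac = X_Gr(E/K_∞⁻)` is `Λ`-torsion at `p ∣ h_K`** (good supersingular `p ≥ 5`, `Surj`,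
classical Heegner, any `N`) — FROM conjunct (5), Castella–Hsu–Kundu–Lee–Liu 2025 Prop. 2.5 (supersingular branch; printed with NO class-number,
square-free or ramified-torsion hypothesis, arXiv:2308.10474v2 p0008 L17–L28; typed verbatim as `CastellaHsuKunduLeeLiu2025.prop25_XAc_isTorsion`,
p739631), by instantiation at `(W, K, 𝔮 = v, 𝔮' = v̄, κ = κ₂, γ = γ₂, N)`: (h0) `E(K)[p] = 0` is DISCHARGED from the binder `Surj` by Gross 1991 §2
(`torsionBy_eq_bot_of_isImaginaryQuadratic`, `p ≠ 2` from `5 ≤ p`); the binders `ι`, `(N, D_K) = 1`, `Odd D_K`, `D_K ≠ -3`, `κ₁`, `f`, the inputs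
and `p ∣ h_K` are not used (so the same term re-closes the `p ∤ h_K` case of the refereed LV19 + CW24 road).  = the glue
`TS1Shape.xAcTorsionSS_classDvd_of_prop25` of `Lines/ratlift_ts1shape.lean` (g28) with its shape hypothesis discharged by the cite.  Print caveat carried
as a flag, not a hypothesis: Prop. 2.5's supersingular proof is one printed sentence «adaptation of [CGLS22, Thm. 3.4.1]» on CW24's signed Kolyvagin system
(`CHKLL-prop25-adaptation`).  The unrefereed CCSS18 Thm 5.7 road (`SignedBaseChangeAcDivXAcTorsion.xAcTorsionSS_of_CCSS18`, p618123) is no longer needed here.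
[cite: CastellaEtAl2025, Prop. 2.5, (h0), §2 setting (arXiv:2308.10474v2 p0008 L17–L28, p0002 L55–L62, p0006 L33–L37)]
[cite: GrossLMS1991, §2 (sentence after (2.2))] [cite: CastellaWan2023, Thm. A.4, Cor. 6.4, Thm. 6.2] -/
theorem xAcTorsionSS_classDvd_closed :
    SignedTwoVariableInputs → Literature.NumberTheory.EllipticCurves.ModularForms.nonempty_modularParametrizationData → ∀ (W : WeierstrassCurve ℚ) [W.IsElliptic] [W.IsGloballyMinimal] (p : ℕ) [Fact p.Prime], 5 ≤ p → W.HasGoodReductionAtPrime p → W.frobeniusTrace p = 0 → Literature.NumberTheory.EllipticCurves.Rank1Residual.Surj W p → ∀ (K : Type) [Field K] [NumberField K] (ι : PadicAlgCl p ≃+* ℂ) (v vbar : IsDedekindDomain.HeightOneSpectrum (NumberField.RingOfIntegers K)) (κ₁ κ₂ : Literature.NumberTheory.EllipticCurves.ZpExtension K p) (γ₁ γ₂ : Field.absoluteGaloisGroup K) [Fact (Literature.NumberTheory.EllipticCurves.ZpExtension.IsTopGeneratorPair κ₁ κ₂ γ₁ γ₂)] [NeZero (NumberField.discr K).natAbs]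 (N : ℕ) [NeZero N] (f : CuspForm (CongruenceSubgroup.Gamma0 N) 2), Literature.NumberTheory.EllipticCurves.ModularForms.IsNewformOf W f → (N : ℤ) = W.conductorNorm ℤ → Literature.NumberTheory.EllipticCurves.IsImaginaryQuadratic K → ((Ideal.span {(p : ℤ)}).primesOver (NumberField.RingOfIntegers K)).ncard = 2 → ((p : ℕ) : NumberField.RingOfIntegers K) ∈ v.asIdeal → ((p : ℕ) : NumberField.RingOfIntegers K) ∈ vbar.asIdeal → vbar ≠ v → (∀ (w : NumberField.InfinitePlace K) (k : NumberField.RingOfIntegers K), k ∈ v.asIdeal ↔ ‖ι.symm (w.embedding (k : K))‖ < 1) → IsCoprime (N : ℤ) (NumberField.discr K) → (∀ ℓ : ℕ, ℓ.Prime → ℓ ∣ N → ((Ideal.span {(ℓ : ℤ)}).primesOver (NumberField.RingOfIntegers K)).ncard = 2) → Odd (NumberField.discr K) → NumberField.discr K ≠ -3 → κ₁.IsCyclotomic → κ₂.IsAnticyclotomic → p ∣ NumberField.classNumber K → (haveI : Fact (κ₂.IsTopGenerator γ₂) := ⟨Literature.NumberTheory.EllipticCurves.YanZhu2026.isTopGenerator_of_pair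 (κ₁ := κ₁) (γ₁ := γ₁)⟩; Module.IsTorsion (Literature.NumberTheory.EllipticCurves.IwasawaAlgebra p) (Literature.NumberTheory.EllipticCurves.Castella2018.AcSelmer.XAc (W.baseChange K) p κ₂ vbar ∅ γ₂)) := by
  -- v5.3: PURE-CITE from conjunct (5) (CHKLL25 Prop. 2.5); (h0) from `Surj` (Gross 1991 §2); `p ∣ h_K` unused.
  intro _ _ W _ _ p _ hp hgood ha0 hs K _ _ ι v vbar κ₁ κ₂ γ₁ γ₂ _ _ N _ f _ hN hK hsplit hv hvbar hvv _ _ hHeeg _ _ _ hκ₂ _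
  haveI : Fact (κ₂.IsTopGenerator γ₂) := ⟨YanZhu2026.isTopGenerator_of_pair (κ₁ := κ₁) (γ₁ := γ₁)⟩
  have hprime : p.Prime := Fact.out
  have h0 : AddSubgroup.torsionBy (W.baseChange K).toAffine.Point (p : ℤ) = ⊥ :=
    torsionBy_eq_bot_of_isImaginaryQuadratic W K hK hprime (by omega) hs
  exact cite_prop25 W K v vbar κ₂ γ₂ N hN hp hgood ha0 hK hsplit hv hvbar hvv hHeeg h0 hκ₂

/-- stub HOW `stub_howardIntegralSS` — **v5.4 STATUS (g32): text byte-identical since v5; CELL C = {`p ∤ h_K`} ∩ {`N` square-free} CLOSED IN-FILE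
(`howardIntegralSS_cellC_closed`, PURE-CITE from conjunct (7) = Castella–Wan 2024 Thm. A.5 + Thm. 6.8, refereed, INTEGRAL — superseding the clause «in the
TREE's refereed typings only RATIONALLY» of the v5 text below and containing the cells A (CHKLL25 Cor. 7.2) and B (Lei–Zhao 2023 Thm. A)); RESIDUAL CONTENT =
{`p ∣ h_K`} ∩ {`N` square-free} (refereed print WITHOUT class-number hypothesis — Castella–Wan MS p. 18 L60–62, p. 25 L23–30, proof of Thm. 6.11 p. 33 —,
untyped: typing want #6 = the SHAPE `hCWA5T68AnyClassNumber` of section `CellC`, which closes `howardIntegralSS_sqfree_of_cwA5T68AnyClassNumber`) ∪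
{`N` not square-free} (no print; = Castella–Wan's printed proof of Thm. A.5 — Lemmas A.1–A.3, Thm. A.4, [How04b, Thm. 2.2.2], [How04a, Thm. 2.2.10], none of
which assumes `N` square-free — with its ONE use of square-freeness, «by [Edi97, Prop. 2.1] our assumption that `N` is squarefree and `p` is supersingular …
implies that the `G_ℚ`-action o[n] `E[p]` is surjective» (MS p. 36 L22–27, footnote 5), replaced by the crux's standing binder `Surj`; kernel form:
`howardIntegralSS_of_cwEulerHalfOn_univ`).**  v5 TEXT: (CONTENT, PRINT-ADJACENT; NEW in v5 — the content half of v4's MIXED stub MU0): at a good SUPERSINGULAR `p ≥ 5`,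
`(spl)`, classical Heegner, `Surj`, ANY `N`, ANY class number: **there is a BDP frame `(Ω_K ≠ 0, Ω_p ∈ R₀ˣ, L = L_p^BDP)` (Castella 2018 Thm 3.1
normalisation `IsBDPLFunction ι v κ₂ γ₂ f Ω_K Ω_p L`) such that along EVERY structure-compatible `j : ℤ_p → R₀`, `L ∈ ch_Λ(X_ac)·R₀⟦T⟧`** — the
INTEGRAL "Howard" (Heegner-point / ±-Kolyvagin-system) lower-half inclusion `(L_p^BDP) ⊆ ch_Λ(X_Gr(E/K_∞⁻))·Λ^ur`.  PRINT: verbatim the conclusion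
(minus its torsion conjunct) of the unrefereed CCSS18 Thm 5.7 + Lemma 5.5 + proof of Thm 5.8 (typed
`CastellaCiperianiSkinnerSprung2018.thm57_lemma55_exists_isBDPLFunction_isTorsion_mem_charIdeal_OPEN`; `howardIntegralSS_of_CCSS18` below, PROVED modulo
that PRE binder).  REFEREED PRINT MAP (cells as on crux 20727): on the cell {`N` square-free ∧ `E[p]` ramified at every `ℓ ∣ N` ∧ `p` totally
ramified in `K_∞⁻/K`} CHKLL25 Thm 7.1 + Cor 7.2 (arXiv:2308.10474 p. 29: "`[CW24, Conj. 5.2]` holds", i.e. the INTEGRAL equality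
`Char_Λ(X_𝔭) Λ^ur = (L_𝔭^BDP)`) ∘ CW24 Thm 5.12 / Thm 6.8 (arXiv:1607.02019 p. 21, p. 23 eq. (div): `Char_{Λ_ac}(X_𝔭) ⊇ (𝓛_𝔭^BDP)²` "as ideals") PRINT
the integral statement, but the TREE types these results only RATIONALLY (`CastellaEtAl2025…_rat`, BLV26 Thm A ∘ CW24 `…_charIdeal_map_le_rat`),
reflecting the `(p)`-part reservation (CW24's signed local conditions are defined after `[1/p]`, arXiv:1607.02019 p. 17) that CCSS18 Lemma 5.5 (♯/♭)
addresses; the INTEGRAL typing of CHKLL25 Cor 7.2 as printed LANDED 2026-08-29 (p739631, conjunct (6)) and makes HOW PURE-CITE on that cell —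
`howardIntegralSS_cellA_closed` below (v5.3); a second refereed integral cell B = Lei–Zhao 2023 Thm. A (arXiv:2211.04377; `Lines/ratlift_cellB_lz23.lean`,
typing want #5) is pending; off the cells
(`ν_ℓ(N) ≥ 2`, `E[p]` unramified at some `ℓ ∣ N`, `p ∣ h_K`) no print.  The ORDINARY twin is refereed and integral under `Surj` (BCS25 Thm 4.2.1 (b)
"Moreover").  By integral cross-period rigidity (`span_singleton_eq_of_isBDPLFunction`) the ∃-frame is as good as every frame.  DIRECTION: HOW is the
Euler-system half; the LEAD's S1 on crux 20727 is the opposite (Eisenstein) half — shared binders and torsion stub, disjoint content.  WHY IT MIGHT FAIL: at `a_p = 0` the ±/♯♭ Kolyvagin-system argument controls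
`length_𝔓` at height-one `𝔓 ≠ (p)`, but at `𝔓 = (p)` (the `μ`-part) the cokernels of the signed Coleman / `Log^±` maps and the local terms at `v ∣ N`
(Tamagawa, additive `v`) must be `p`-adic units — the slack the tree's `_rat` typings absorb into `p^k`; a counterexample would be a curve with
`μ(X_ac) > 0 = μ(L_p^BDP)`.  Token (390): CONTENT (cell-A reducible to PURE-CITE by an integral typing).
[claim: CastellaCiperianiSkinnerSprung2018, status: under-review]
[cite: CastellaCiperianiSkinnerSprung2018, Thm. 5.7, Lemma 5.5, proof of Thm. 5.8 (arXiv:1804.10993v2 §5.1, pp. 21–23)]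
[cite: CastellaWan2023, Thm. 5.12, Thm. 6.8, proof of Thm. 6.1 eq. (div)] [cite: CastellaEtAl2025, Thm. 7.1, Cor. 7.2 (arXiv:2308.10474 p. 29)]
[cite: BurungaleCastellaSkinner2025, Thm. 4.2.1 (b)] [cite: Howard2004HeegnerKolyvagin, Thm. 2.2.10] -/
theorem stub_howardIntegralSS :
    SignedTwoVariableInputs → Literature.NumberTheory.EllipticCurves.ModularForms.nonempty_modularParametrizationData → ∀ (W : WeierstrassCurve ℚ) [W.IsElliptic] [W.IsGloballyMinimal] (p : ℕ) [Fact p.Prime], 5 ≤ p → W.HasGoodReductionAtPrime p → W.frobeniusTrace p = 0 → Literature.NumberTheory.EllipticCurves.Rank1Residual.Surj W p → ∀ (K : Type) [Field K] [NumberField K] (ι : PadicAlgCl p ≃+* ℂ) (v vbar : IsDedekindDomain.HeightOneSpectrum (NumberField.RingOfIntegers K)) (κ₁ κ₂ : Literature.NumberTheory.EllipticCurves.ZpExtension K p) (γ₁ γ₂ : Field.absoluteGaloisGroup K) [Fact (Literature.NumberTheory.EllipticCurves.ZpExtension.IsTopGeneratorPair κ₁ κ₂ γ₁ γ₂)] [NeZero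 (NumberField.discr K).natAbs] (N : ℕ) [NeZero N] (f : CuspForm (CongruenceSubgroup.Gamma0 N) 2), Literature.NumberTheory.EllipticCurves.ModularForms.IsNewformOf W f → (N : ℤ) = W.conductorNorm ℤ → Literature.NumberTheory.EllipticCurves.IsImaginaryQuadratic K → ((Ideal.span {(p : ℤ)}).primesOver (NumberField.RingOfIntegers K)).ncard = 2 → ((p : ℕ) : NumberField.RingOfIntegers K) ∈ v.asIdeal → ((p : ℕ) : NumberField.RingOfIntegers K) ∈ vbar.asIdeal → vbar ≠ v → (∀ (w : NumberField.InfinitePlace K) (k : NumberField.RingOfIntegers K), k ∈ v.asIdeal ↔ ‖ι.symm (w.embedding (k : K))‖ < 1) → IsCoprime (N : ℤ) (NumberField.discr K) → (∀ ℓ : ℕ, ℓ.Prime → ℓ ∣ N → ((Ideal.span {(ℓ : ℤ)}).primesOver (NumberField.RingOfIntegers K)).ncard = 2) → Odd (NumberField.discr K) → NumberField.discr K ≠ -3 → κ₁.IsCyclotomic → κ₂.IsAnticyclotomic → (haveI : Fact (κ₂.IsTopGenerator γ₂) := ⟨Literature.NumberTheory.EllipticCurves.YanZhu2026.isTopGenerator_of_pair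 (κ₁ := κ₁) (γ₁ := γ₁)⟩; ∃ (ΩK : ℂ) (Ωp : (Literature.NumberTheory.EllipticCurves.unrIntegers p)ˣ) (L : Literature.NumberTheory.EllipticCurves.UnrSeries p), ΩK ≠ 0 ∧ Literature.NumberTheory.EllipticCurves.IsBDPLFunction ι v κ₂ γ₂ f ΩK ((Ωp : Literature.NumberTheory.EllipticCurves.unrIntegers p) : PadicComplex p) L ∧ ∀ j : ℤ_[p] →+* Literature.NumberTheory.EllipticCurves.unrIntegers p, (∀ x : ℤ_[p], ((j x : Literature.NumberTheory.EllipticCurves.unrIntegers p) : PadicComplex p) = algebraMap ℚ_[p] (PadicComplex p) (x : ℚ_[p])) → L ∈ (Literature.NumberTheory.EllipticCurves.Castella2018.AcSelmer.XAc.charIdeal (W.baseChange K) p κ₂ vbar ∅ γ₂).map (PowerSeries.map j)) := by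
  sorry

/-- stub F1 `stub_ratEulerSystemSS` (RESEARCH, LOAD-BEARING; the transfer target C⁺; text unchanged since v1): **the RATIONAL two-variable
Euler-system inclusion at a good SUPERSINGULAR prime** — `∃ a, (p^a · G) ⊆ ch_{Λ_K}(X_Gr(E/K̃_∞)) · 𝒪⟦T₁,T₂⟧`, i.e. the crux in `Λ^ur ⊗ ℚ_p`
(`μ`-part forgotten). Strictly weaker than the crux. Shape: what a two-variable (signed) Beilinson–Flach / BSTW zeta-element argument natively
gives; no Λ-integral engine at `a_p = 0` is in print (BSTW24 §1.4.1 announces one).  WHY IT MIGHT FAIL: the signed two-variable classes of BSTW24 are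
built for `𝔫 = 1` / semistable levels and their reciprocity laws at `a_p = 0` are proved after inverting `p` and off a divisor — a genuinely
two-variable rational inclusion for every `N` and every frame is not in print.  Token (390): CONTENT (research).
[cite: BurungaleSkinnerTianWan2024, §1.4.1, Props. 11.8, 2.7, 5.19] [cite: LoefflerZerbes2016, Thm. 3.5.9] -/
theorem stub_ratEulerSystemSS :
    SignedTwoVariableInputs → Literature.NumberTheory.EllipticCurves.ModularForms.nonempty_modularParametrizationData → ∀ (W : WeierstrassCurve ℚ) [W.IsElliptic] [W.IsGloballyMinimal] (p : ℕ) [Fact p.Prime], 5 ≤ p → W.HasGoodReductionAtPrime p → W.frobeniusTrace p = 0 → Literature.NumberTheory.EllipticCurves.Rank1Residual.Surj W p → ∀ (K : Type) [Field K] [NumberField K] (ι : PadicAlgCl p ≃+* ℂ) (v vbar : IsDedekindDomain.HeightOneSpectrum (NumberField.RingOfIntegers K)) (κ₁ κ₂ : Literature.NumberTheory.EllipticCurves.ZpExtension K p) (γ₁ γ₂ : Field.absoluteGaloisGroup K) [Fact (Literature.NumberTheory.EllipticCurves.ZpExtension.IsTopGeneratorPair κ₁ κ₂ γ₁ γ₂)]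 [NeZero (NumberField.discr K).natAbs] (N : ℕ) [NeZero N] (f : CuspForm (CongruenceSubgroup.Gamma0 N) 2), Literature.NumberTheory.EllipticCurves.ModularForms.IsNewformOf W f → (N : ℤ) = W.conductorNorm ℤ → Literature.NumberTheory.EllipticCurves.IsImaginaryQuadratic K → ((Ideal.span {(p : ℤ)}).primesOver (NumberField.RingOfIntegers K)).ncard = 2 → ((p : ℕ) : NumberField.RingOfIntegers K) ∈ v.asIdeal → ((p : ℕ) : NumberField.RingOfIntegers K) ∈ vbar.asIdeal → vbar ≠ v → (∀ (w : NumberField.InfinitePlace K) (k : NumberField.RingOfIntegers K), k ∈ v.asIdeal ↔ ‖ι.symm (w.embedding (k : K))‖ < 1) → IsCoprime (N : ℤ) (NumberField.discr K) → (∀ ℓ : ℕ, ℓ.Prime → ℓ ∣ N → ((Ideal.span {(ℓ : ℤ)}).primesOver (NumberField.RingOfIntegers K)).ncard = 2) → Odd (NumberField.discr K) → NumberField.discr K ≠ -3 → κ₁.IsCyclotomic → κ₂.IsAnticyclotomic → ∀ (Ω δ : ℂ) (Ωp : (Literature.NumberTheory.EllipticCurves.unrIntegers p)ˣ) (LK G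 : PowerSeries (PowerSeries (PadicComplexInt p))), Ω ≠ 0 → (δ ^ 2 = (NumberField.discr K : ℂ) ∨ δ ^ 2 = -(NumberField.discr K : ℂ)) → Literature.NumberTheory.EllipticCurves.IsKatzMeasure₂ ι v vbar ∅ κ₁ κ₂ γ₁⁻¹ γ₂⁻¹ 1 Ω δ ((Ωp : Literature.NumberTheory.EllipticCurves.unrIntegers p) : PadicComplex p) LK → Literature.NumberTheory.EllipticCurves.IsGreenbergLFunctionAnyRoot₂ ι v vbar κ₁ κ₂ γ₁⁻¹ γ₂⁻¹ f (NumberField.discr K).natAbs (NumberField.classNumber K) LK G → ∀ J : ℤ_[p] →+* PadicComplexInt p, (∀ x : ℤ_[p], ((J x : PadicComplexInt p) : PadicComplex p) = ((x : ℚ_[p]) : PadicComplex p)) → ∃ a : ℕ, Ideal.span {((p : ℕ) : PowerSeries (PowerSeries (PadicComplexInt p))) ^ a * G} ≤ (WeierstrassCurve.XGr₂.charIdeal (W.baseChange K) p κ₁ κ₂ vbar γ₁ γ₂).map (Literature.NumberTheory.EllipticCurves.IwasawaAlgebra₂.toUnr₂ p J) := by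
  sorry

/-! ## In-file `_closed` theorems (VARIANT-N (ii)): ORD (PURE-CITE), TS1 (MIXED), HOW modulo its PRE binder (documentation) -/

/-- **ORD closed (PURE-CITE)**: the ORDINARY slice of the crux — v4's `stub_ordSliceES` text — from conjunct (1) through the tree theorem
`SignedBaseChangeEsDivOrdinary.esChild_of_goodOrd` (p552655).  [cite: YanZhu2024MainConjNonCM, Thm. 4.2 (2) with (Im), Thm. 4.7, Thm. 3.3] -/
theorem ordSliceES_closed :
    SignedTwoVariableInputs → Literature.NumberTheory.EllipticCurves.ModularForms.nonempty_modularParametrizationData → ∀ (W : WeierstrassCurve ℚ) [W.IsElliptic] [W.IsGloballyMinimal] (p : ℕ) [Fact p.Prime], 5 ≤ p → W.HasGoodReductionAtPrime p → Literature.NumberTheory.EllipticCurves.Rank1Residual.GoodOrd W p → Literature.NumberTheory.EllipticCurves.Rank1Residual.Surj W p → ∀ (K : Type) [Field K] [NumberField K] (ι : PadicAlgCl p ≃+* ℂ) (v vbar : IsDedekindDomain.HeightOneSpectrum (NumberField.RingOfIntegers K)) (κ₁ κ₂ : Literature.NumberTheory.EllipticCurves.ZpExtension K p) (γ₁ γ₂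 : Field.absoluteGaloisGroup K) [Fact (Literature.NumberTheory.EllipticCurves.ZpExtension.IsTopGeneratorPair κ₁ κ₂ γ₁ γ₂)] [NeZero (NumberField.discr K).natAbs] (N : ℕ) [NeZero N] (f : CuspForm (CongruenceSubgroup.Gamma0 N) 2), Literature.NumberTheory.EllipticCurves.ModularForms.IsNewformOf W f → (N : ℤ) = W.conductorNorm ℤ → Literature.NumberTheory.EllipticCurves.IsImaginaryQuadratic K → ((Ideal.span {(p : ℤ)}).primesOver (NumberField.RingOfIntegers K)).ncard = 2 → ((p : ℕ) : NumberField.RingOfIntegers K) ∈ v.asIdeal → ((p : ℕ) : NumberField.RingOfIntegers K) ∈ vbar.asIdeal → vbar ≠ v → (∀ (w : NumberField.InfinitePlace K) (k : NumberField.RingOfIntegers K), k ∈ v.asIdeal ↔ ‖ι.symm (w.embedding (k : K))‖ < 1) → IsCoprime (N : ℤ) (NumberField.discr K) → (∀ ℓ : ℕ, ℓ.Prime → ℓ ∣ N → ((Ideal.span {(ℓ : ℤ)}).primesOver (NumberField.RingOfIntegers K)).ncard = 2) → Odd (NumberField.discr K) → NumberField.discr K ≠ -3 → κ₁.IsCyclotomic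 → κ₂.IsAnticyclotomic → ∀ (Ω δ : ℂ) (Ωp : (Literature.NumberTheory.EllipticCurves.unrIntegers p)ˣ) (LK G : PowerSeries (PowerSeries (PadicComplexInt p))), Ω ≠ 0 → (δ ^ 2 = (NumberField.discr K : ℂ) ∨ δ ^ 2 = -(NumberField.discr K : ℂ)) → Literature.NumberTheory.EllipticCurves.IsKatzMeasure₂ ι v vbar ∅ κ₁ κ₂ γ₁⁻¹ γ₂⁻¹ 1 Ω δ ((Ωp : Literature.NumberTheory.EllipticCurves.unrIntegers p) : PadicComplex p) LK → Literature.NumberTheory.EllipticCurves.IsGreenbergLFunctionAnyRoot₂ ι v vbar κ₁ κ₂ γ₁⁻¹ γ₂⁻¹ f (NumberField.discr K).natAbs (NumberField.classNumber K) LK G → ∀ J : ℤ_[p] →+* PadicComplexInt p, (∀ x : ℤ_[p], ((J x : PadicComplexInt p) : PadicComplex p) = ((x : ℚ_[p]) : PadicComplex p)) → Ideal.span {G} ≤ (WeierstrassCurve.XGr₂.charIdeal (W.baseChange K) p κ₁ κ₂ vbar γ₁ γ₂).map (Literature.NumberTheory.EllipticCurves.IwasawaAlgebra₂.toUnr₂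 p J) :=
  Summit.BirchSwinnertonDyer.BirchSwinnertonDyer.Theorems.SignedBaseChangeEsDivOrdinary.esChild_of_goodOrd cite_yz.1 cite_yz.2.1 cite_yz.2.2

/-- **TS1 closed (MIXED → TS1∣)**: v4's `stub_xAcTorsionSS` text (= `Bdpline.stub_xAcTorsionSS`, crux 20727) from conjuncts (2), (3) off `p ∣ h_K`
(tree `SignedBaseChangeAcDivOfFactsRefereed.xAcTorsionSS_of_refereed_of_classDvd` ∘ `…XAcTorsionOfLongoVigni.xAcTorsionSS_of_longoVigni_castellaWan`,
p632902) and, at `p ∣ h_K`, from `xAcTorsionSS_classDvd_closed` (v5.3: conjunct (5), CHKLL25 Prop. 2.5 — formerly the shared PRE stub).  PURE-CITE.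
[cite: LongoVigni2019, Thm. 1.4] [cite: CastellaWan2023, Thm. 6.8] [cite: CastellaEtAl2025, Prop. 2.5 (arXiv:2308.10474v2 p0008 L17–L28)] -/
theorem xAcTorsionSS_closed :
    SignedTwoVariableInputs → Literature.NumberTheory.EllipticCurves.ModularForms.nonempty_modularParametrizationData → ∀ (W : WeierstrassCurve ℚ) [W.IsElliptic] [W.IsGloballyMinimal] (p : ℕ) [Fact p.Prime], 5 ≤ p → W.HasGoodReductionAtPrime p → W.frobeniusTrace p = 0 → Literature.NumberTheory.EllipticCurves.Rank1Residual.Surj W p → ∀ (K : Type) [Field K] [NumberField K] (ι : PadicAlgCl p ≃+* ℂ) (v vbar : IsDedekindDomain.HeightOneSpectrum (NumberField.RingOfIntegers K)) (κ₁ κ₂ : Literature.NumberTheory.EllipticCurves.ZpExtension K p) (γ₁ γ₂ : Field.absoluteGaloisGroup K) [Fact (Literature.NumberTheory.EllipticCurves.ZpExtension.IsTopGeneratorPair κ₁ κ₂ γ₁ γ₂)] [NeZero (NumberField.discr K).natAbs] (N : ℕ) [NeZero N] (f : CuspForm (CongruenceSubgroup.Gamma0 N) 2), Literature.NumberTheory.EllipticCurves.ModularForms.IsNewformOf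 W f → (N : ℤ) = W.conductorNorm ℤ → Literature.NumberTheory.EllipticCurves.IsImaginaryQuadratic K → ((Ideal.span {(p : ℤ)}).primesOver (NumberField.RingOfIntegers K)).ncard = 2 → ((p : ℕ) : NumberField.RingOfIntegers K) ∈ v.asIdeal → ((p : ℕ) : NumberField.RingOfIntegers K) ∈ vbar.asIdeal → vbar ≠ v → (∀ (w : NumberField.InfinitePlace K) (k : NumberField.RingOfIntegers K), k ∈ v.asIdeal ↔ ‖ι.symm (w.embedding (k : K))‖ < 1) → IsCoprime (N : ℤ) (NumberField.discr K) → (∀ ℓ : ℕ, ℓ.Prime → ℓ ∣ N → ((Ideal.span {(ℓ : ℤ)}).primesOver (NumberField.RingOfIntegers K)).ncard = 2) → Odd (NumberField.discr K) → NumberField.discr K ≠ -3 → κ₁.IsCyclotomic → κ₂.IsAnticyclotomic → (haveI : Fact (κ₂.IsTopGenerator γ₂) := ⟨Literature.NumberTheory.EllipticCurves.YanZhu2026.isTopGenerator_of_pair (κ₁ := κ₁) (γ₁ := γ₁)⟩; Module.IsTorsion (Literature.NumberTheory.EllipticCurves.IwasawaAlgebra p) (Literature.NumberTheory.EllipticCurves.Castella2018.AcSelmer.XAc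 (W.baseChange K) p κ₂ vbar ∅ γ₂)) :=
  Summit.BirchSwinnertonDyer.BirchSwinnertonDyer.Theorems.SignedBaseChangeAcDivOfFactsRefereed.xAcTorsionSS_of_refereed_of_classDvd
    cite_lv14 cite_cwInputs xAcTorsionSS_classDvd_closed

/-- **HOW modulo the PRE binder** (documentation of the print road, PROVED): the unrefereed CCSS18 Thm 5.7 + Lemma 5.5 claim, as typed, gives
`stub_howardIntegralSS` verbatim (instantiate at `κ = κ₂`, `γ = γ₂`, `𝔭 = v`, `𝔭̄ = v̄`; `GoodSS` from good reduction and `a_p = 0`; (irr_K) from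
`Surj` by `Rank1Residual.irrK_of_surj`).  [claim: CastellaCiperianiSkinnerSprung2018, status: under-review]
[cite: CastellaCiperianiSkinnerSprung2018, Thm. 5.7 and Lemma 5.5 (arXiv:1804.10993v2 §5.1, pp. 21–23)] -/
theorem howardIntegralSS_of_CCSS18
    (h57 : Literature.NumberTheory.EllipticCurves.CastellaCiperianiSkinnerSprung2018.thm57_lemma55_exists_isBDPLFunction_isTorsion_mem_charIdeal_OPEN) :
    SignedTwoVariableInputs → Literature.NumberTheory.EllipticCurves.ModularForms.nonempty_modularParametrizationData → ∀ (W : WeierstrassCurve ℚ) [W.IsElliptic] [W.IsGloballyMinimal] (p : ℕ) [Fact p.Prime], 5 ≤ p → W.HasGoodReductionAtPrime p → W.frobeniusTrace p = 0 → Literature.NumberTheory.EllipticCurves.Rank1Residual.Surj W p → ∀ (K : Type) [Field K] [NumberField K] (ι : PadicAlgCl p ≃+* ℂ) (v vbar : IsDedekindDomain.HeightOneSpectrum (NumberField.RingOfIntegers K)) (κ₁ κ₂ : Literature.NumberTheory.EllipticCurves.ZpExtension K p) (γ₁ γ₂ : Field.absoluteGaloisGroup K) [Fact (Literature.NumberTheory.EllipticCurves.ZpExtension.IsTopGeneratorPair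 κ₁ κ₂ γ₁ γ₂)] [NeZero (NumberField.discr K).natAbs] (N : ℕ) [NeZero N] (f : CuspForm (CongruenceSubgroup.Gamma0 N) 2), Literature.NumberTheory.EllipticCurves.ModularForms.IsNewformOf W f → (N : ℤ) = W.conductorNorm ℤ → Literature.NumberTheory.EllipticCurves.IsImaginaryQuadratic K → ((Ideal.span {(p : ℤ)}).primesOver (NumberField.RingOfIntegers K)).ncard = 2 → ((p : ℕ) : NumberField.RingOfIntegers K) ∈ v.asIdeal → ((p : ℕ) : NumberField.RingOfIntegers K) ∈ vbar.asIdeal → vbar ≠ v → (∀ (w : NumberField.InfinitePlace K) (k : NumberField.RingOfIntegers K), k ∈ v.asIdeal ↔ ‖ι.symm (w.embedding (k : K))‖ < 1) → IsCoprime (N : ℤ) (NumberField.discr K) → (∀ ℓ : ℕ, ℓ.Prime → ℓ ∣ N → ((Ideal.span {(ℓ : ℤ)}).primesOver (NumberField.RingOfIntegers K)).ncard = 2) → Odd (NumberField.discr K) → NumberField.discr K ≠ -3 → κ₁.IsCyclotomic → κ₂.IsAnticyclotomic → (haveI : Fact (κ₂.IsTopGenerator γ₂) := ⟨Literature.NumberTheory.EllipticCurves.YanZhu2026.isTopGenerator_of_pair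 (κ₁ := κ₁) (γ₁ := γ₁)⟩; ∃ (ΩK : ℂ) (Ωp : (Literature.NumberTheory.EllipticCurves.unrIntegers p)ˣ) (L : Literature.NumberTheory.EllipticCurves.UnrSeries p), ΩK ≠ 0 ∧ Literature.NumberTheory.EllipticCurves.IsBDPLFunction ι v κ₂ γ₂ f ΩK ((Ωp : Literature.NumberTheory.EllipticCurves.unrIntegers p) : PadicComplex p) L ∧ ∀ j : ℤ_[p] →+* Literature.NumberTheory.EllipticCurves.unrIntegers p, (∀ x : ℤ_[p], ((j x : Literature.NumberTheory.EllipticCurves.unrIntegers p) : PadicComplex p) = algebraMap ℚ_[p] (PadicComplex p) (x : ℚ_[p])) → L ∈ (Literature.NumberTheory.EllipticCurves.Castella2018.AcSelmer.XAc.charIdeal (W.baseChange K) p κ₂ vbar ∅ γ₂).map (PowerSeries.map j)) := by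
  intro _ _ W _ _ p _ hp hgood ha0 hs K _ _ ι v vbar κ₁ κ₂ γ₁ γ₂ _ _ N _ f hf _ hK hsplit _ hvbar hvv hι _ hHeeg _
    _ _ hκ₂
  have hp2 : p ≠ 2 := by omega
  have hss : Rank1Residual.GoodSS W p := ⟨hgood, by rw [ha0]; exact dvd_zero _⟩
  have hirr : (W.baseChange K).HasIrreducibleModPGaloisRep p :=
    Summit.BirchSwinnertonDyer.Rank1Residual.irrK_of_surj W p hs K hK.1
  haveI : Fact (κ₂.IsTopGenerator γ₂) := ⟨YanZhu2026.isTopGenerator_of_pair (κ₁ := κ₁) (γ₁ := γ₁)⟩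
  obtain ⟨ΩK, Ωp, L, hΩK, hL, -, hmem⟩ := h57 ι W K v vbar κ₂ γ₂ hf hp2 hss hK hHeeg hsplit hirr hι hvbar hvv hκ₂
  exact ⟨ΩK, Ωp, L, hΩK, hL, hmem⟩

/-! ## HOW on CELL A from an INTEGRAL typing of CHKLL25 Cor. 7.2 (v5.2; documentation, PROVED modulo a displayed SHAPE hypothesis)

Cell A of HOW's cell map (`Lines/ratlift.md` §V5-RECUT) = {`N` square-free} ∩ {`E[p]` ramified at every `ℓ ∣ N`} ∩ {`p ∤ h_K`} — exactly the
hypotheses (i), (ii), (iv) of Castella–Hsu–Kundu–Lee–Liu 2025 Thm. 7.1 / Cor. 7.2 at `N⁻ = 1` (arXiv:2308.10474v2 p0029 L28–L42), whose printed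
conclusion is Castella–Wan's 5.2 IN FULL: `X^{rel,str}` is `Λ^ac`-torsion and `char_{Λac}(X^{rel,str})Λ^ur = (L_p^BDP)` — an INTEGRAL EQUALITY.  The
tree types this source only RATIONALLY and only as its Eisenstein half (`CastellaHsuKunduLeeLiu2025.thm71_cor72_exists_isCWBDPLFunction_charIdeal_map_le_rat`,
whose docstring ends `-- TODO(general form): the integral equality and the torsion clause of 5.2`).  The two section HYPOTHESES below are the SHAPES a
typer would give that TODO (binders BYTE-PARALLEL to the `_rat` def; conclusion in the same Castella–Wan frame currency):
`hCor72IntegralEquality` = 5.2 verbatim (torsion ∧ `ch·R₀⟦T⟧ = (L)` along every compatible structure map `j`), `hCor72IntegralEulerHalf` = its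
Euler-system half `(L) ⊆ ch·R₀⟦T⟧` alone.  They are `variable`s INCLUDED as explicit hypotheses of the three theorems of this section — NO proposition
is defined in this file, nothing is asserted, no `_holds`; typing the source is a Literature task (TYPING WANT #1 of this line, director-bsd REQUESTS
2026-08-29), not done here — DONE 2026-08-29 by the typer row (xiv) `bsd-ssimc-ty-acsignedGeneral` (p739631): SHAPE 2 is now, verbatim, the Literature
named fact `CastellaHsuKunduLeeLiu2025.thm71_cor72_isTorsion_charIdeal_map_eq` (conjunct (6) of the cite stub), and `howardIntegralSS_cellA_closed` (right
after this section, v5.3) discharges the hypothesis; the section is kept as the documentation of the glue.  `cor72Rat_of_integralEquality` checks that the equality shape refines the tree's typed `_rat` fact (`k = 0`).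

THE GLUE (kernel-checked, no `sorry`): `howardIntegralSS_cellA_of_cor72IntegralEulerHalf` — the text of `stub_howardIntegralSS` with the three
cell-A binders `¬ p ∣ NumberField.classNumber K →`, `Squarefree N →`, "`E[p]` ramified at every prime `q ∣ N`" inserted after `κ₂.IsAnticyclotomic →`
(the position used by `SignedBaseChangeAcDivBdpLowerHalfSemistable.bdpLowerHalfRatSS_semistable_of_CHKLL` on crux 20727) — follows from the Euler-half
shape: instantiate it at `(ι, W, K, v, v̄, κ₂, γ₂, f)` (Castella–Wan frame `(Ω_K^W, Ω_p^W, L_W)`, `L_W ∈ ch·R₀⟦T⟧`); take ANY Castella-2018 frame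
`(Ω_K′, Ω_p′, L′)` (conjunct (4), BCS25 Prop. 4.2.2 — only its `IsBDPLFunction` clause is used; (irr_K) from `Surj`); the FRAME CONCORDANCE
`SignedBaseChangeAcDivFrameConcordance.span_map_eq_of_isCWBDPLFunction_of_isBDPLFunction` (p634869; `p ∤ N` from good reduction, `p ∤ D_K` from
`p` split) gives `(L_W) = (L′)` in `𝓞_{ℂ_p}⟦T⟧`; the DESCENT `X11b.unrSeries_mem_span_singleton_of_map_mem` (value descent, `Frac R₀ ∩ 𝓞_{ℂ_p} = R₀`)
gives `L′ ∈ (L_W)` in `R₀⟦T⟧`, hence `L′ ∈ ch·R₀⟦T⟧` along every compatible `j`.  So an integral typing of Cor. 7.2 (either shape) makes HOW PURE-CITE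
on cell A; off cell A (`ν_ℓ(N) ≥ 2` for some `ℓ`, or `E[p]` unramified at some `ℓ ∣ N`, or `p ∣ h_K`) HOW stays CONTENT (PRE CCSS18 Thm. 5.7 / Lemma
5.5 only).  No summit statement, crux or stub is proved by this section; BSD is not proved. -/

section CellA

/- SHAPE 1 (section hypothesis; nothing asserted): the INTEGRAL EULER-SYSTEM HALF of CHKLL25 Cor. 7.2 at `N⁻ = 1` — binders byte-parallel to the
tree's `CastellaHsuKunduLeeLiu2025.thm71_cor72_exists_isCWBDPLFunction_charIdeal_map_le_rat` ((R1)–(R5) of that file), conclusion: a Castella–Wan frame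
`(Ω_K ≠ 0, Ω_p ∈ R₀ˣ, L)` with `IsCWBDPLFunction ι 𝔭 κ γ f D_K Ω_K Ω_p L` and, along every structure map `j : ℤ_p → R₀` compatible with `ℤ_p ⊂ ℂ_p`,
the INTEGRAL inclusion `(L) ⊆ char_Λ(X_ac strict at 𝔭̄)·R₀⟦T⟧`.
[cite: CastellaEtAl2025, Thm. 7.1 and Cor. 7.2 (arXiv:2308.10474v2 p0029 L28–L42)] [cite: CastellaWan2023, 5.2 and Def. 5.1 (MS p. 23), Prop. 2.1 (MS pp. 5–6)] -/
variable (hCor72IntegralEulerHalf :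
  ∀ {p : ℕ} [Fact p.Prime] (ι : PadicAlgCl p ≃+* ℂ) (W : WeierstrassCurve ℚ) [W.IsElliptic] [W.IsGloballyMinimal]
    (K : Type) [Field K] [NumberField K] (𝔭 𝔭bar : IsDedekindDomain.HeightOneSpectrum (NumberField.RingOfIntegers K))
    (κ : ZpExtension K p) (γ : Field.absoluteGaloisGroup K) [Fact (κ.IsTopGenerator γ)] {N : ℕ} [NeZero N]
    {f : CuspForm (CongruenceSubgroup.Gamma0 N) 2} (_ : ModularForms.IsNewformOf W f),
    (N : ℤ) = W.conductorNorm ℤ → 5 ≤ p → W.HasGoodReductionAtPrime p → W.frobeniusTrace p = 0 → Rank1Residual.Surj W p →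
    IsImaginaryQuadratic K → ((Ideal.span {(p : ℤ)}).primesOver (NumberField.RingOfIntegers K)).ncard = 2 →
      ((p : ℕ) : NumberField.RingOfIntegers K) ∈ 𝔭.asIdeal →
      (∀ (w : NumberField.InfinitePlace K) (k : NumberField.RingOfIntegers K), k ∈ 𝔭.asIdeal ↔ ‖ι.symm (w.embedding (k : K))‖ < 1) →
      ((p : ℕ) : NumberField.RingOfIntegers K) ∈ 𝔭bar.asIdeal → 𝔭bar ≠ 𝔭 →
    (∀ ℓ : ℕ, ℓ.Prime → ℓ ∣ N → ((Ideal.span {(ℓ : ℤ)}).primesOver (NumberField.RingOfIntegers K)).ncard = 2) →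
    IsCoprime (N : ℤ) (NumberField.discr K) → ¬ p ∣ NumberField.classNumber K →
    Squarefree N →
    (∀ q : ℕ, q.Prime → q ∣ N →
      ∃ v : IsDedekindDomain.HeightOneSpectrum (NumberField.RingOfIntegers ℚ), ((q : ℕ) : NumberField.RingOfIntegers ℚ) ∈ v.asIdeal ∧
        ∃ 𝔓 ∈ v.primesAbove, ∃ σ ∈ 𝔓.inertia (Field.absoluteGaloisGroup ℚ), ∃ P : W.geomTorsion (p : ℤ), σ • P ≠ P) →
    κ.IsAnticyclotomic →
    ∃ (ΩK : ℂ) (Ωp : (unrIntegers p)ˣ) (L : UnrSeries p),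
      ΩK ≠ 0 ∧
      CastellaWan2024.IsCWBDPLFunction ι 𝔭 κ γ f (NumberField.discr K) ΩK ((Ωp : unrIntegers p) : PadicComplex p) L ∧
      ∀ (j : ℤ_[p] →+* unrIntegers p),
        (∀ x : ℤ_[p], ((j x : unrIntegers p) : PadicComplex p) = algebraMap ℚ_[p] (PadicComplex p) (x : ℚ_[p])) →
        Ideal.span {L} ≤ (Castella2018.AcSelmer.XAc.charIdeal (W.baseChange K) p κ 𝔭bar ∅ γ).map (PowerSeries.map j))

/- SHAPE 2 (section hypothesis; nothing asserted): Castella–Wan's 5.2 IN FULL on the cell of CHKLL25 Cor. 7.2 at `N⁻ = 1` — same binders; conclusion: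
`X_ac = AcSelmer.XAc (W⁄K) p κ 𝔭̄ ∅ γ` (= `X^{rel,str}` by Shapiro, flag `CW24-53-orientation-L33`) is `Λ`-torsion AND there is a Castella–Wan frame
with, along every compatible structure map `j`, the INTEGRAL EQUALITY `char_Λ(X_ac)·R₀⟦T⟧ = (L)` — the literal content of the source's
`TODO(general form): the integral equality and the torsion clause of 5.2`.
[cite: CastellaEtAl2025, Thm. 7.1 and Cor. 7.2 (arXiv:2308.10474v2 p0029 L28–L42)] [cite: CastellaWan2023, 5.2 and Def. 5.1 (MS p. 23)] -/
variable (hCor72IntegralEquality :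
  ∀ {p : ℕ} [Fact p.Prime] (ι : PadicAlgCl p ≃+* ℂ) (W : WeierstrassCurve ℚ) [W.IsElliptic] [W.IsGloballyMinimal]
    (K : Type) [Field K] [NumberField K] (𝔭 𝔭bar : IsDedekindDomain.HeightOneSpectrum (NumberField.RingOfIntegers K))
    (κ : ZpExtension K p) (γ : Field.absoluteGaloisGroup K) [Fact (κ.IsTopGenerator γ)] {N : ℕ} [NeZero N]
    {f : CuspForm (CongruenceSubgroup.Gamma0 N) 2} (_ : ModularForms.IsNewformOf W f),
    (N : ℤ) = W.conductorNorm ℤ → 5 ≤ p → W.HasGoodReductionAtPrime p → W.frobeniusTrace p = 0 → Rank1Residual.Surj W p →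
    IsImaginaryQuadratic K → ((Ideal.span {(p : ℤ)}).primesOver (NumberField.RingOfIntegers K)).ncard = 2 →
      ((p : ℕ) : NumberField.RingOfIntegers K) ∈ 𝔭.asIdeal →
      (∀ (w : NumberField.InfinitePlace K) (k : NumberField.RingOfIntegers K), k ∈ 𝔭.asIdeal ↔ ‖ι.symm (w.embedding (k : K))‖ < 1) →
      ((p : ℕ) : NumberField.RingOfIntegers K) ∈ 𝔭bar.asIdeal → 𝔭bar ≠ 𝔭 →
    (∀ ℓ : ℕ, ℓ.Prime → ℓ ∣ N → ((Ideal.span {(ℓ : ℤ)}).primesOver (NumberField.RingOfIntegers K)).ncard = 2) →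
    IsCoprime (N : ℤ) (NumberField.discr K) → ¬ p ∣ NumberField.classNumber K →
    Squarefree N →
    (∀ q : ℕ, q.Prime → q ∣ N →
      ∃ v : IsDedekindDomain.HeightOneSpectrum (NumberField.RingOfIntegers ℚ), ((q : ℕ) : NumberField.RingOfIntegers ℚ) ∈ v.asIdeal ∧
        ∃ 𝔓 ∈ v.primesAbove, ∃ σ ∈ 𝔓.inertia (Field.absoluteGaloisGroup ℚ), ∃ P : W.geomTorsion (p : ℤ), σ • P ≠ P) →
    κ.IsAnticyclotomic →
    Module.IsTorsion (IwasawaAlgebra p) (Castella2018.AcSelmer.XAc (W.baseChange K) p κ 𝔭bar ∅ γ) ∧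
    ∃ (ΩK : ℂ) (Ωp : (unrIntegers p)ˣ) (L : UnrSeries p),
      ΩK ≠ 0 ∧
      CastellaWan2024.IsCWBDPLFunction ι 𝔭 κ γ f (NumberField.discr K) ΩK ((Ωp : unrIntegers p) : PadicComplex p) L ∧
      ∀ (j : ℤ_[p] →+* unrIntegers p),
        (∀ x : ℤ_[p], ((j x : unrIntegers p) : PadicComplex p) = algebraMap ℚ_[p] (PadicComplex p) (x : ℚ_[p])) →
        (Castella2018.AcSelmer.XAc.charIdeal (W.baseChange K) p κ 𝔭bar ∅ γ).map (PowerSeries.map j) = Ideal.span {L})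

include hCor72IntegralEquality in
/-- The equality shape refines the tree's TYPED rational fact (`k = 0`): sanity link between the wanted typing and the existing one.
CONDITIONAL on the displayed shape hypothesis. [cite: CastellaEtAl2025, Thm. 7.1 and Cor. 7.2 (arXiv:2308.10474v2 p0029 L28–L42)] -/
theorem cor72Rat_of_integralEquality :
    CastellaHsuKunduLeeLiu2025.thm71_cor72_exists_isCWBDPLFunction_charIdeal_map_le_rat := by
  intro p _ ι W _ _ K _ _ 𝔭 𝔭bar κ γ _ N _ f hf hN hp hgood ha0 hs hK hsplit h𝔭 hι h𝔭bar hne hHeeg hcop hh hsqf hram hκ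
  obtain ⟨-, ΩK, Ωp, L, hΩK, hL, hEq⟩ :=
    hCor72IntegralEquality ι W K 𝔭 𝔭bar κ γ hf hN hp hgood ha0 hs hK hsplit h𝔭 hι h𝔭bar hne hHeeg hcop hh hsqf hram hκ
  refine ⟨ΩK, Ωp, L, hΩK, hL, fun j hj ↦ ⟨0, ?_⟩⟩
  rw [pow_zero, map_one, Ideal.span_singleton_one, Ideal.top_mul]
  exact (hEq j hj).le

include hCor72IntegralEulerHalf in
/-- **HOW on CELL A (kernel glue, no `sorry`)**: the text of `stub_howardIntegralSS` with the cell-A binders `¬ p ∣ NumberField.classNumber K →`,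
`Squarefree N →`, "`E[p]` ramified at every prime `q ∣ N`" inserted after `κ₂.IsAnticyclotomic →`, FROM the integral Euler-half SHAPE of CHKLL25
Cor. 7.2 (section hypothesis `hCor72IntegralEulerHalf`, displayed as the first binder).  Proof: the shape at `(ι, W, K, v, v̄, κ₂, γ₂, f)` gives a
Castella–Wan frame `(Ω_K^W, Ω_p^W, L_W)` with `L_W ∈ ch·R₀⟦T⟧` along every compatible `j`; conjunct (4) gives SOME Castella-2018 frame
`(Ω_K′, Ω_p′, L′)` ((irr_K) from `Surj`); frame concordance (p634869) gives `(L_W) = (L′)` in `𝓞_{ℂ_p}⟦T⟧` (`p ∤ N`: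
`not_dvd_conductorNorm_of_hasGoodReductionAtPrime`; `p ∤ D_K`: `not_dvd_discr_of_ncard_primesOver`); descent
`X11b.unrSeries_mem_span_singleton_of_map_mem` gives `L′ = u·L_W` in `R₀⟦T⟧`; hence `L′ ∈ ch·R₀⟦T⟧`.  CONDITIONAL on the displayed shape hypothesis
(to be discharged by a Literature typing of the printed Cor. 7.2; not by this file).
[cite: CastellaEtAl2025, Thm. 7.1 and Cor. 7.2 (arXiv:2308.10474v2 p0029 L28–L42)] [cite: CastellaWan2023, Prop. 2.1 (MS pp. 5–6), 5.2 (MS p. 23)]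
[cite: Castella2018, Thm. 3.1, Def. 2.2, §3 (arXiv:1704.06608 p. 9)] [cite: BurungaleCastellaSkinner2025, Prop. 4.2.2] -/
theorem howardIntegralSS_cellA_of_cor72IntegralEulerHalf :
    SignedTwoVariableInputs → Literature.NumberTheory.EllipticCurves.ModularForms.nonempty_modularParametrizationData → ∀ (W : WeierstrassCurve ℚ) [W.IsElliptic] [W.IsGloballyMinimal] (p : ℕ) [Fact p.Prime], 5 ≤ p → W.HasGoodReductionAtPrime p → W.frobeniusTrace p = 0 → Literature.NumberTheory.EllipticCurves.Rank1Residual.Surj W p → ∀ (K : Type) [Field K] [NumberField K] (ι : PadicAlgCl p ≃+* ℂ) (v vbar : IsDedekindDomain.HeightOneSpectrum (NumberField.RingOfIntegers K)) (κ₁ κ₂ : Literature.NumberTheory.EllipticCurves.ZpExtension K p) (γ₁ γ₂ : Field.absoluteGaloisGroup K) [Fact (Literature.NumberTheory.EllipticCurves.ZpExtension.IsTopGeneratorPair κ₁ κ₂ γ₁ γ₂)] [NeZero (NumberField.discr K).natAbs] (N : ℕ) [NeZero N] (f : CuspForm (CongruenceSubgroup.Gamma0 N) 2), Literature.NumberTheory.EllipticCurves.ModularForms.IsNewformOf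 W f → (N : ℤ) = W.conductorNorm ℤ → Literature.NumberTheory.EllipticCurves.IsImaginaryQuadratic K → ((Ideal.span {(p : ℤ)}).primesOver (NumberField.RingOfIntegers K)).ncard = 2 → ((p : ℕ) : NumberField.RingOfIntegers K) ∈ v.asIdeal → ((p : ℕ) : NumberField.RingOfIntegers K) ∈ vbar.asIdeal → vbar ≠ v → (∀ (w : NumberField.InfinitePlace K) (k : NumberField.RingOfIntegers K), k ∈ v.asIdeal ↔ ‖ι.symm (w.embedding (k : K))‖ < 1) → IsCoprime (N : ℤ) (NumberField.discr K) → (∀ ℓ : ℕ, ℓ.Prime → ℓ ∣ N → ((Ideal.span {(ℓ : ℤ)}).primesOver (NumberField.RingOfIntegers K)).ncard = 2) → Odd (NumberField.discr K) → NumberField.discr K ≠ -3 → κ₁.IsCyclotomic → κ₂.IsAnticyclotomic → ¬ p ∣ NumberField.classNumber K → Squarefree N → (∀ q : ℕ, q.Prime → q ∣ N → ∃ v : IsDedekindDomain.HeightOneSpectrum (NumberField.RingOfIntegers ℚ), ((q : ℕ) : NumberField.RingOfIntegers ℚ) ∈ v.asIdeal ∧ ∃ 𝔓 ∈ v.primesAbove,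 ∃ σ ∈ 𝔓.inertia (Field.absoluteGaloisGroup ℚ), ∃ P : W.geomTorsion (p : ℤ), σ • P ≠ P) → (haveI : Fact (κ₂.IsTopGenerator γ₂) := ⟨Literature.NumberTheory.EllipticCurves.YanZhu2026.isTopGenerator_of_pair (κ₁ := κ₁) (γ₁ := γ₁)⟩; ∃ (ΩK : ℂ) (Ωp : (Literature.NumberTheory.EllipticCurves.unrIntegers p)ˣ) (L : Literature.NumberTheory.EllipticCurves.UnrSeries p), ΩK ≠ 0 ∧ Literature.NumberTheory.EllipticCurves.IsBDPLFunction ι v κ₂ γ₂ f ΩK ((Ωp : Literature.NumberTheory.EllipticCurves.unrIntegers p) : PadicComplex p) L ∧ ∀ j : ℤ_[p] →+* Literature.NumberTheory.EllipticCurves.unrIntegers p, (∀ x : ℤ_[p], ((j x : Literature.NumberTheory.EllipticCurves.unrIntegers p) : PadicComplex p) = algebraMap ℚ_[p] (PadicComplex p) (x : ℚ_[p])) → L ∈ (Literature.NumberTheory.EllipticCurves.Castella2018.AcSelmer.XAc.charIdeal (W.baseChange K) p κ₂ vbar ∅ γ₂).map (PowerSeries.map j)) := by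
  intro hIn hmodP W _ _ p _ hp hgood ha0 hs K _ _ ι v vbar κ₁ κ₂ γ₁ γ₂ _ _ N _ f hf hN hK hsplit hv hvbar hvv hι hcop hHeeg hodd
    hne3 hκ₁ hκ₂ hh hsqf hram
  haveI hγ₂ : Fact (κ₂.IsTopGenerator γ₂) := ⟨YanZhu2026.isTopGenerator_of_pair (κ₁ := κ₁) (γ₁ := γ₁)⟩
  have hprime : p.Prime := Fact.out
  have hp2 : p ≠ 2 := by omega
  have hirr : (W.baseChange K).HasIrreducibleModPGaloisRep p :=
    Summit.BirchSwinnertonDyer.Rank1Residual.irrK_of_surj W p hs K hK.1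
  -- (1) the Castella–Wan frame of the integral Euler-half shape: `L_W ∈ ch·R₀⟦T⟧` along every compatible `j`
  obtain ⟨ΩKw, Ωpw, LW, hΩKw, hLW, hmemW⟩ :=
    hCor72IntegralEulerHalf ι W K v vbar κ₂ γ₂ hf hN hp hgood ha0 hs hK hsplit hv hι hvbar hvv hHeeg hcop hh hsqf hram hκ₂
  -- (2) some Castella-2018 frame (conjunct (4); only its `IsBDPLFunction` clause is used)
  obtain ⟨ΩK', Ωp', L', hΩK', hL', -⟩ := cite_prop422 ι W K v κ₂ γ₂ hf (by omega) hgood hK hHeeg hsplit hodd hne3 hirr hv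
    hι hκ₂ hγ₂.out
  -- (3) frame concordance in `𝓞_{ℂ_p}⟦T⟧`: `(L_W) = (L')`
  have hN' : (W.conductorNorm ℤ : ℕ) = N := by exact_mod_cast hN.symm
  have hpN : ¬ p ∣ N := by
    rw [← hN']
    exact not_dvd_conductorNorm_of_hasGoodReductionAtPrime W hgood
  have hpD : ¬ (p : ℤ) ∣ NumberField.discr K :=
    not_dvd_discr_of_ncard_primesOver hprime (by rw [hK.1]; exact hsplit)
  have hΩpw : ((Ωpw : unrIntegers p) : ℂ_[p]) ≠ 0 := fun h0 ↦ by
    have h1 := (unrIntegers.isUnit_iff_norm_eq_one (Ωpw : unrIntegers p)).mp Ωpw.isUnit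
    rw [h0, norm_zero] at h1
    exact zero_ne_one h1
  have hΩp' : ((Ωp' : unrIntegers p) : ℂ_[p]) ≠ 0 := fun h0 ↦ by
    have h1 := (unrIntegers.isUnit_iff_norm_eq_one (Ωp' : unrIntegers p)).mp Ωp'.isUnit
    rw [h0, norm_zero] at h1
    exact zero_ne_one h1
  have hconc : Ideal.span {PowerSeries.map (Summit.BirchSwinnertonDyer.Rank1Residual.X11b.R1.unrToCpInt p) LW} =
      Ideal.span {PowerSeries.map (Summit.BirchSwinnertonDyer.Rank1Residual.X11b.R1.unrToCpInt p) L'} :=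
    Summit.BirchSwinnertonDyer.BirchSwinnertonDyer.Theorems.SignedBaseChangeAcDivFrameConcordance.span_map_eq_of_isCWBDPLFunction_of_isBDPLFunction
      hp2 hK hκ₂ hγ₂.out hpN hpD hΩKw hΩK' hΩpw hΩp' hLW hL'
  -- (4) descent to `R₀⟦T⟧`: `L' ∈ (L_W)`, i.e. `L' = u * L_W`
  have hL'mem : L' ∈ Ideal.span ({LW} : Set (UnrSeries p)) :=
    Summit.BirchSwinnertonDyer.Rank1Residual.X11b.unrSeries_mem_span_singleton_of_map_mem (by
      rw [hconc]
      exact Ideal.mem_span_singleton_self _)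
  obtain ⟨u, hu⟩ := Ideal.mem_span_singleton'.mp hL'mem
  -- (5) the Castella-2018 frame `(Ω_K', Ω_p', L')` is the witness: `L' = u * L_W ∈ ch·R₀⟦T⟧`
  refine ⟨ΩK', Ωp', L', hΩK', hL', fun j hj ↦ ?_⟩
  rw [← hu]
  exact Ideal.mul_mem_left _ u (hmemW j hj (Ideal.mem_span_singleton_self LW))

include hCor72IntegralEquality in
/-- **HOW on CELL A from the full 5.2 shape** (torsion ∧ integral equality; section hypothesis `hCor72IntegralEquality`, displayed as the first binder):
through the Euler-half glue.  CONDITIONAL on the displayed shape hypothesis. [cite: CastellaEtAl2025, Thm. 7.1 and Cor. 7.2 (arXiv:2308.10474v2 p0029 L28–L42)] -/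
theorem howardIntegralSS_cellA_of_cor72IntegralEquality :
    SignedTwoVariableInputs → Literature.NumberTheory.EllipticCurves.ModularForms.nonempty_modularParametrizationData → ∀ (W : WeierstrassCurve ℚ) [W.IsElliptic] [W.IsGloballyMinimal] (p : ℕ) [Fact p.Prime], 5 ≤ p → W.HasGoodReductionAtPrime p → W.frobeniusTrace p = 0 → Literature.NumberTheory.EllipticCurves.Rank1Residual.Surj W p → ∀ (K : Type) [Field K] [NumberField K] (ι : PadicAlgCl p ≃+* ℂ) (v vbar : IsDedekindDomain.HeightOneSpectrum (NumberField.RingOfIntegers K)) (κ₁ κ₂ : Literature.NumberTheory.EllipticCurves.ZpExtension K p) (γ₁ γ₂ : Field.absoluteGaloisGroup K) [Fact (Literature.NumberTheory.EllipticCurves.ZpExtension.IsTopGeneratorPair κ₁ κ₂ γ₁ γ₂)] [NeZero (NumberField.discr K).natAbs] (N : ℕ) [NeZero N] (f : CuspForm (CongruenceSubgroup.Gamma0 N) 2), Literature.NumberTheory.EllipticCurves.ModularForms.IsNewformOf W f → (N : ℤ) = W.conductorNorm ℤ → Literature.NumberTheory.EllipticCurves.IsImaginaryQuadratic K → ((Ideal.span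 {(p : ℤ)}).primesOver (NumberField.RingOfIntegers K)).ncard = 2 → ((p : ℕ) : NumberField.RingOfIntegers K) ∈ v.asIdeal → ((p : ℕ) : NumberField.RingOfIntegers K) ∈ vbar.asIdeal → vbar ≠ v → (∀ (w : NumberField.InfinitePlace K) (k : NumberField.RingOfIntegers K), k ∈ v.asIdeal ↔ ‖ι.symm (w.embedding (k : K))‖ < 1) → IsCoprime (N : ℤ) (NumberField.discr K) → (∀ ℓ : ℕ, ℓ.Prime → ℓ ∣ N → ((Ideal.span {(ℓ : ℤ)}).primesOver (NumberField.RingOfIntegers K)).ncard = 2) → Odd (NumberField.discr K) → NumberField.discr K ≠ -3 → κ₁.IsCyclotomic → κ₂.IsAnticyclotomic → ¬ p ∣ NumberField.classNumber K → Squarefree N → (∀ q : ℕ, q.Prime → q ∣ N → ∃ v : IsDedekindDomain.HeightOneSpectrum (NumberField.RingOfIntegers ℚ), ((q : ℕ) : NumberField.RingOfIntegers ℚ) ∈ v.asIdeal ∧ ∃ 𝔓 ∈ v.primesAbove, ∃ σ ∈ 𝔓.inertia (Field.absoluteGaloisGroup ℚ), ∃ P : W.geomTorsion (p : ℤ), σ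 • P ≠ P) → (haveI : Fact (κ₂.IsTopGenerator γ₂) := ⟨Literature.NumberTheory.EllipticCurves.YanZhu2026.isTopGenerator_of_pair (κ₁ := κ₁) (γ₁ := γ₁)⟩; ∃ (ΩK : ℂ) (Ωp : (Literature.NumberTheory.EllipticCurves.unrIntegers p)ˣ) (L : Literature.NumberTheory.EllipticCurves.UnrSeries p), ΩK ≠ 0 ∧ Literature.NumberTheory.EllipticCurves.IsBDPLFunction ι v κ₂ γ₂ f ΩK ((Ωp : Literature.NumberTheory.EllipticCurves.unrIntegers p) : PadicComplex p) L ∧ ∀ j : ℤ_[p] →+* Literature.NumberTheory.EllipticCurves.unrIntegers p, (∀ x : ℤ_[p], ((j x : Literature.NumberTheory.EllipticCurves.unrIntegers p) : PadicComplex p) = algebraMap ℚ_[p] (PadicComplex p) (x : ℚ_[p])) → L ∈ (Literature.NumberTheory.EllipticCurves.Castella2018.AcSelmer.XAc.charIdeal (W.baseChange K) p κ₂ vbar ∅ γ₂).map (PowerSeries.map j)) := by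
  refine howardIntegralSS_cellA_of_cor72IntegralEulerHalf ?_
  intro p _ ι W _ _ K _ _ 𝔭 𝔭bar κ γ _ N _ f hf hN hp hgood ha0 hs hK hsplit h𝔭 hι h𝔭bar hne hHeeg hcop hh hsqf hram hκ
  obtain ⟨-, ΩK, Ωp, L, hΩK, hL, hEq⟩ :=
    hCor72IntegralEquality ι W K 𝔭 𝔭bar κ γ hf hN hp hgood ha0 hs hK hsplit h𝔭 hι h𝔭bar hne hHeeg hcop hh hsqf hram hκ
  exact ⟨ΩK, Ωp, L, hΩK, hL, fun j hj ↦ (hEq j hj).ge⟩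

end CellA

/-! ## HOW on CELL A — CLOSED by the landed cite (v5.3) -/

/-- **HOW on CELL A — CLOSED (v5.3, PURE-CITE; no shape hypothesis left)**: the text of `stub_howardIntegralSS` with the cell-A binders
`¬ p ∣ NumberField.classNumber K →`, `Squarefree N →`, "`E[p]` ramified at every prime `q ∣ N`" inserted after `κ₂.IsAnticyclotomic →`, FROM conjunct
(6) = the Literature named fact `CastellaHsuKunduLeeLiu2025.thm71_cor72_isTorsion_charIdeal_map_eq` (CHKLL25 Thm. 7.1 / Cor. 7.2 INTEGRAL at `N⁻ = 1`,
typed by the row (xiv) typer, p739631, in exactly the SHAPE 2 `hCor72IntegralEquality` of the section `CellA` above) through `howardIntegralSS_cellA_of_cor72IntegralEquality` (frame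
concordance p634869 + descent).  On cell A = {`N` square-free} ∩ {`E[p]` ramified at every `ℓ ∣ N`} ∩ {`p ∤ h_K`} HOW is therefore PURE-CITE; the
registered stub `stub_howardIntegralSS` (all `N`, all `h_K`) stays ONE content stub (cell B = Lei–Zhao 2023 Thm. A pending typing want #5; residual
{`N` not square-free} ∪ {`p ∣ h_K`} ∪ ({`p ∣ φ(N)`} ∩ {`E[p]` unramified at some `ℓ ∣ N`}) in no refereed print).  No summit statement, crux or
registered stub is proved by this theorem; BSD is not proved.
[cite: CastellaEtAl2025, Thm. 7.1 and Cor. 7.2 (arXiv:2308.10474v2 p0029 L28–L42)] [cite: CastellaWan2023, Prop. 2.1 (MS pp. 5–6), 5.2 (MS p. 23), Thm. 6.8]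
[cite: Castella2018, Thm. 3.1, Def. 2.2] [cite: BurungaleCastellaSkinner2025, Prop. 4.2.2] -/
theorem howardIntegralSS_cellA_closed :
    SignedTwoVariableInputs → Literature.NumberTheory.EllipticCurves.ModularForms.nonempty_modularParametrizationData → ∀ (W : WeierstrassCurve ℚ) [W.IsElliptic] [W.IsGloballyMinimal] (p : ℕ) [Fact p.Prime], 5 ≤ p → W.HasGoodReductionAtPrime p → W.frobeniusTrace p = 0 → Literature.NumberTheory.EllipticCurves.Rank1Residual.Surj W p → ∀ (K : Type) [Field K] [NumberField K] (ι : PadicAlgCl p ≃+* ℂ) (v vbar : IsDedekindDomain.HeightOneSpectrum (NumberField.RingOfIntegers K)) (κ₁ κ₂ : Literature.NumberTheory.EllipticCurves.ZpExtension K p) (γ₁ γ₂ : Field.absoluteGaloisGroup K) [Fact (Literature.NumberTheory.EllipticCurves.ZpExtension.IsTopGeneratorPair κ₁ κ₂ γ₁ γ₂)] [NeZero (NumberField.discr K).natAbs] (N : ℕ) [NeZero N] (f : CuspForm (CongruenceSubgroup.Gamma0 N) 2), Literature.NumberTheory.EllipticCurves.ModularForms.IsNewformOf W f → (N : ℤ)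 = W.conductorNorm ℤ → Literature.NumberTheory.EllipticCurves.IsImaginaryQuadratic K → ((Ideal.span {(p : ℤ)}).primesOver (NumberField.RingOfIntegers K)).ncard = 2 → ((p : ℕ) : NumberField.RingOfIntegers K) ∈ v.asIdeal → ((p : ℕ) : NumberField.RingOfIntegers K) ∈ vbar.asIdeal → vbar ≠ v → (∀ (w : NumberField.InfinitePlace K) (k : NumberField.RingOfIntegers K), k ∈ v.asIdeal ↔ ‖ι.symm (w.embedding (k : K))‖ < 1) → IsCoprime (N : ℤ) (NumberField.discr K) → (∀ ℓ : ℕ, ℓ.Prime → ℓ ∣ N → ((Ideal.span {(ℓ : ℤ)}).primesOver (NumberField.RingOfIntegers K)).ncard = 2) → Odd (NumberField.discr K) → NumberField.discr K ≠ -3 → κ₁.IsCyclotomic → κ₂.IsAnticyclotomic → ¬ p ∣ NumberField.classNumber K → Squarefree N → (∀ q : ℕ, q.Prime → q ∣ N → ∃ v : IsDedekindDomain.HeightOneSpectrum (NumberField.RingOfIntegers ℚ), ((q : ℕ) : NumberField.RingOfIntegers ℚ) ∈ v.asIdeal ∧ ∃ 𝔓 ∈ v.primesAbove, ∃ σ ∈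 𝔓.inertia (Field.absoluteGaloisGroup ℚ), ∃ P : W.geomTorsion (p : ℤ), σ • P ≠ P) → (haveI : Fact (κ₂.IsTopGenerator γ₂) := ⟨Literature.NumberTheory.EllipticCurves.YanZhu2026.isTopGenerator_of_pair (κ₁ := κ₁) (γ₁ := γ₁)⟩; ∃ (ΩK : ℂ) (Ωp : (Literature.NumberTheory.EllipticCurves.unrIntegers p)ˣ) (L : Literature.NumberTheory.EllipticCurves.UnrSeries p), ΩK ≠ 0 ∧ Literature.NumberTheory.EllipticCurves.IsBDPLFunction ι v κ₂ γ₂ f ΩK ((Ωp : Literature.NumberTheory.EllipticCurves.unrIntegers p) : PadicComplex p) L ∧ ∀ j : ℤ_[p] →+* Literature.NumberTheory.EllipticCurves.unrIntegers p, (∀ x : ℤ_[p], ((j x : Literature.NumberTheory.EllipticCurves.unrIntegers p) : PadicComplex p) = algebraMap ℚ_[p] (PadicComplex p) (x : ℚ_[p])) → L ∈ (Literature.NumberTheory.EllipticCurves.Castella2018.AcSelmer.XAc.charIdeal (W.baseChange K) p κ₂ vbar ∅ γ₂).map (PowerSeries.map j)) :=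
  howardIntegralSS_cellA_of_cor72IntegralEquality @cite_cor72eq

/-! ## HOW on CELL C ⊋ A ∪ B from Castella–Wan 2024 Thm. A.5 + Thm. 6.8 (v5.4, g32): ONE glue on an arbitrary cell · the all-`h_K` SHAPE (typing want #6) · closure

LENS `complete` FINDING (g32, first-hand reading of the authors' accepted MS `paper:url-7157bd4f7b88` of [CastellaWan2023] = Math. Ann. 389 (2024)
2595–2636, pp. 18, 25, 29–36): (i) the refereed INTEGRAL Euler-system half of Castella–Wan's 5.2 at `N⁻ = 1` — Thm. A.5 («Assume that `N` is
squarefree. Then … `char_{Λac}(M) ⊃ char_{Λac}(Sel_±(K, 𝐓^ac)/Λ^ac z^±_∞)` in `Λ^ac`», MS pp. 35–36) composed with Thm. 6.8 («The same result holds for the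
opposite divisibilities», MS p. 30; proof = the ideal identity `char(X^{rel,str}) · char(Sel_±/Λ^ac z^±_∞)² Λ^ur = char(X^±_tors) · (L_p^BDP)²`, MS p. 31
L1–L30) — IS ALREADY TYPED in the tree as `AcSigned.castellaWan2024_thmA5_thm68_bdp_mem_charIdeal` (2026-08-28; conjunct (7)); its cell {`p ∤ h_K`} ∩
{`N` square-free} CONTAINS cell A (CHKLL25 Cor. 7.2: + «`E[p]` ramified at every `q ∣ N`») and cell B (Lei–Zhao 2023 Thm. A: + `p ∤ φ(N)`, `D_K` odd);
(ii) the journal text carries NO class-number hypothesis («there exists a non-negative integer `δ` such that `L_{n+1+δ} = K[p^n]` for `n ≫ 0`, with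
`δ = 0` when the class number of `K` is coprime to `p`», MS p. 18 L60–62; §6.1 works with `L₀ := K^ac_∞ ∩ H_K`, `M ⩾ 0`, MS p. 25 L23–30; the proof of Thm.
6.11, MS p. 33 L3–L12, chooses `K` by (a)–(e) with no class-number condition) — the tree's `AcSigned.Setting.not_dvd_classNumber` is the TYPING's
restriction (flag `delta-zero` of the signed carriers), and the composite's conclusion mentions no signed carrier, so the all-`h_K` statement SHAPE 4 below is
print-faithful and carrier-free (typing want #6); (iii) «`N` squarefree» enters the printed proof of Thm. A.5 ONLY as «by [Edi97, Prop. 2.1] our assumption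
that `N` is squarefree and `p` is supersingular (so in particular, `E[p]` is an irreducible `G_ℚ`-module) implies that the `G_ℚ`-action o[n] `E[p]` is
surjective» (MS p. 36 L22–27; footnote 5 «We thank the anonymous referee for bringing this result to our attention»): Lemmas A.1–A.3, Thm. A.4 (the
Kolyvagin system `p^d · κ^±`, `d` from [How04b, Prop. 3.4.1 (15)] at `v ∣ N`), [How04b, Thm. 2.2.2], [How04a, Thm. 2.2.10], Lemma 6.5, Lemma 6.7, Thm. 6.2 and
Thm. 6.8 assume nothing on `N` beyond (gen-H); the crux carries `Rank1Residual.Surj W p` as a standing binder.  Nothing here is a Literature fact beyond (7);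
no summit statement, crux or registered stub is proved by this section; BSD is not proved. -/

section CellC

/- A CELL: an arbitrary predicate of `(E, K, p, N)` cutting out the sub-family on which the Castella–Wan-currency Euler half is supplied. -/
variable (Extra : WeierstrassCurve ℚ → (K : Type) → [Field K] → [NumberField K] → ℕ → ℕ → Prop)

/- SHAPE 3 (section hypothesis; nothing asserted): the INTEGRAL EULER-SYSTEM HALF of Castella–Wan's 5.2 in CASTELLA–WAN CURRENCY on the cell `Extra` —
binders = those of SHAPE 1 of section `CellA` minus the three cell-A binders, plus `Extra W K p N`; conclusion = VERBATIM the third conjunct of the tree's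
`AcSigned.castellaWan2024_thmA5_thm68_bdp_mem_charIdeal` at `(𝔭, 𝔭') = (𝔭, 𝔭bar)`: a Castella–Wan frame `(Ω_K ≠ 0, Ω_p ∈ R₀ˣ, L)` with
`IsCWBDPLFunction ι 𝔭 κ γ f D_K Ω_K Ω_p L` and, along every structure map `j : ℤ_p → R₀` compatible with `ℤ_p ⊂ ℂ_p`, `L ∈ char_Λ(X_ac strict at 𝔭̄)·R₀⟦T⟧`.
[cite: CastellaWan2023, Thm. A.5 (MS pp. 35–36), Thm. 6.8 (MS pp. 29–31), 5.2 and Def. 5.1 (MS p. 23), Prop. 2.1 (MS pp. 5–6)] -/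
variable (hCWEulerHalfOn :
  ∀ {p : ℕ} [Fact p.Prime] (ι : PadicAlgCl p ≃+* ℂ) (W : WeierstrassCurve ℚ) [W.IsElliptic] [W.IsGloballyMinimal]
    (K : Type) [Field K] [NumberField K] (𝔭 𝔭bar : IsDedekindDomain.HeightOneSpectrum (NumberField.RingOfIntegers K))
    (κ : ZpExtension K p) (γ : Field.absoluteGaloisGroup K) [Fact (κ.IsTopGenerator γ)] {N : ℕ} [NeZero N]
    {f : CuspForm (CongruenceSubgroup.Gamma0 N) 2} (_ : ModularForms.IsNewformOf W f),
    (N : ℤ) = W.conductorNorm ℤ → 5 ≤ p → W.HasGoodReductionAtPrime p → W.frobeniusTrace p = 0 → Rank1Residual.Surj W p →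
    IsImaginaryQuadratic K → ((Ideal.span {(p : ℤ)}).primesOver (NumberField.RingOfIntegers K)).ncard = 2 →
      ((p : ℕ) : NumberField.RingOfIntegers K) ∈ 𝔭.asIdeal →
      (∀ (w : NumberField.InfinitePlace K) (k : NumberField.RingOfIntegers K), k ∈ 𝔭.asIdeal ↔ ‖ι.symm (w.embedding (k : K))‖ < 1) →
      ((p : ℕ) : NumberField.RingOfIntegers K) ∈ 𝔭bar.asIdeal → 𝔭bar ≠ 𝔭 →
    (∀ ℓ : ℕ, ℓ.Prime → ℓ ∣ N → ((Ideal.span {(ℓ : ℤ)}).primesOver (NumberField.RingOfIntegers K)).ncard = 2) →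
    IsCoprime (N : ℤ) (NumberField.discr K) → κ.IsAnticyclotomic → Extra W K p N →
    ∃ (ΩK : ℂ) (Ωp : (unrIntegers p)ˣ) (L : UnrSeries p),
      ΩK ≠ 0 ∧
      CastellaWan2024.IsCWBDPLFunction ι 𝔭 κ γ f (NumberField.discr K) ΩK ((Ωp : unrIntegers p) : PadicComplex p) L ∧
      ∀ (j : ℤ_[p] →+* unrIntegers p),
        (∀ x : ℤ_[p], ((j x : unrIntegers p) : PadicComplex p) = algebraMap ℚ_[p] (PadicComplex p) (x : ℚ_[p])) →
        L ∈ (Castella2018.AcSelmer.XAc.charIdeal (W.baseChange K) p κ 𝔭bar ∅ γ).map (PowerSeries.map j))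

include hCWEulerHalfOn in
/-- **HOW on the cell `Extra` (kernel glue, no `sorry`; v5.4)**: the text of `stub_howardIntegralSS` with the binder `Extra W K p N →` inserted after
`κ₂.IsAnticyclotomic →`, FROM the Castella–Wan-currency Euler half on the same cell (SHAPE 3, displayed as the section hypothesis).  Proof = the cell-A
glue verbatim: the shape at `(ι, W, K, v, v̄, κ₂, γ₂, f)` gives a Castella–Wan frame `(Ω_K^W, Ω_p^W, L_W)` with `L_W ∈ ch·R₀⟦T⟧` along every compatible `j`;
conjunct (4) gives SOME Castella-2018 frame `(Ω_K′, Ω_p′, L′)` ((irr_K) from `Surj`); frame concordance (p634869) gives `(L_W) = (L′)` in `𝓞_{ℂ_p}⟦T⟧`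
(`p ∤ N`, `p ∤ D_K`); descent `X11b.unrSeries_mem_span_singleton_of_map_mem` gives `L′ = u·L_W` in `R₀⟦T⟧`; hence `L′ ∈ ch·R₀⟦T⟧`.  The cell predicate is
never inspected.  CONDITIONAL on the displayed shape hypothesis.
[cite: CastellaWan2023, Thm. A.5, Thm. 6.8, Prop. 2.1 (MS pp. 5–6, 29–31, 35–36)] [cite: Castella2018, Thm. 3.1, Def. 2.2, §3 (arXiv:1704.06608 p. 9)]
[cite: BurungaleCastellaSkinner2025, Prop. 4.2.2] -/
theorem howardIntegralSS_on_of_cwEulerHalfOn :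
    SignedTwoVariableInputs → Literature.NumberTheory.EllipticCurves.ModularForms.nonempty_modularParametrizationData → ∀ (W : WeierstrassCurve ℚ) [W.IsElliptic] [W.IsGloballyMinimal] (p : ℕ) [Fact p.Prime], 5 ≤ p → W.HasGoodReductionAtPrime p → W.frobeniusTrace p = 0 → Literature.NumberTheory.EllipticCurves.Rank1Residual.Surj W p → ∀ (K : Type) [Field K] [NumberField K] (ι : PadicAlgCl p ≃+* ℂ) (v vbar : IsDedekindDomain.HeightOneSpectrum (NumberField.RingOfIntegers K)) (κ₁ κ₂ : Literature.NumberTheory.EllipticCurves.ZpExtension K p) (γ₁ γ₂ : Field.absoluteGaloisGroup K) [Fact (Literature.NumberTheory.EllipticCurves.ZpExtension.IsTopGeneratorPair κ₁ κ₂ γ₁ γ₂)] [NeZero (NumberField.discr K).natAbs] (N : ℕ) [NeZero N] (f : CuspForm (CongruenceSubgroup.Gamma0 N) 2), Literature.NumberTheory.EllipticCurves.ModularForms.IsNewformOf W f → (N : ℤ) = W.conductorNorm ℤ → Literature.NumberTheory.EllipticCurves.IsImaginaryQuadratic K → ((Ideal.span {(p : ℤ)}).primesOver (NumberField.RingOfIntegers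 K)).ncard = 2 → ((p : ℕ) : NumberField.RingOfIntegers K) ∈ v.asIdeal → ((p : ℕ) : NumberField.RingOfIntegers K) ∈ vbar.asIdeal → vbar ≠ v → (∀ (w : NumberField.InfinitePlace K) (k : NumberField.RingOfIntegers K), k ∈ v.asIdeal ↔ ‖ι.symm (w.embedding (k : K))‖ < 1) → IsCoprime (N : ℤ) (NumberField.discr K) → (∀ ℓ : ℕ, ℓ.Prime → ℓ ∣ N → ((Ideal.span {(ℓ : ℤ)}).primesOver (NumberField.RingOfIntegers K)).ncard = 2) → Odd (NumberField.discr K) → NumberField.discr K ≠ -3 → κ₁.IsCyclotomic → κ₂.IsAnticyclotomic → Extra W K p N → (haveI : Fact (κ₂.IsTopGenerator γ₂) := ⟨Literature.NumberTheory.EllipticCurves.YanZhu2026.isTopGenerator_of_pair (κ₁ := κ₁) (γ₁ := γ₁)⟩; ∃ (ΩK : ℂ) (Ωp : (Literature.NumberTheory.EllipticCurves.unrIntegers p)ˣ) (L : Literature.NumberTheory.EllipticCurves.UnrSeries p), ΩK ≠ 0 ∧ Literature.NumberTheory.EllipticCurves.IsBDPLFunction ι v κ₂ γ₂ f ΩK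 ((Ωp : Literature.NumberTheory.EllipticCurves.unrIntegers p) : PadicComplex p) L ∧ ∀ j : ℤ_[p] →+* Literature.NumberTheory.EllipticCurves.unrIntegers p, (∀ x : ℤ_[p], ((j x : Literature.NumberTheory.EllipticCurves.unrIntegers p) : PadicComplex p) = algebraMap ℚ_[p] (PadicComplex p) (x : ℚ_[p])) → L ∈ (Literature.NumberTheory.EllipticCurves.Castella2018.AcSelmer.XAc.charIdeal (W.baseChange K) p κ₂ vbar ∅ γ₂).map (PowerSeries.map j)) := by
  intro hIn hmodP W _ _ p _ hp hgood ha0 hs K _ _ ι v vbar κ₁ κ₂ γ₁ γ₂ _ _ N _ f hf hN hK hsplit hv hvbar hvv hι hcop hHeeg hodd hne3 hκ₁ hκ₂ hX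
  haveI hγ₂ : Fact (κ₂.IsTopGenerator γ₂) := ⟨YanZhu2026.isTopGenerator_of_pair (κ₁ := κ₁) (γ₁ := γ₁)⟩
  have hprime : p.Prime := Fact.out
  have hp2 : p ≠ 2 := by omega
  have hirr : (W.baseChange K).HasIrreducibleModPGaloisRep p :=
    Summit.BirchSwinnertonDyer.Rank1Residual.irrK_of_surj W p hs K hK.1
  -- (1) the Castella–Wan frame of the Euler-half shape on the cell: `L_W ∈ ch·R₀⟦T⟧` along every compatible `j`
  obtain ⟨ΩKw, Ωpw, LW, hΩKw, hLW, hmemW⟩ :=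
    hCWEulerHalfOn ι W K v vbar κ₂ γ₂ hf hN hp hgood ha0 hs hK hsplit hv hι hvbar hvv hHeeg hcop hκ₂ hX
  -- (2) some Castella-2018 frame (conjunct (4); only its `IsBDPLFunction` clause is used)
  obtain ⟨ΩK', Ωp', L', hΩK', hL', -⟩ := cite_prop422 ι W K v κ₂ γ₂ hf (by omega) hgood hK hHeeg hsplit hodd hne3 hirr hv
    hι hκ₂ hγ₂.out
  -- (3) frame concordance in `𝓞_{ℂ_p}⟦T⟧`: `(L_W) = (L')`
  have hN' : (W.conductorNorm ℤ : ℕ) = N := by exact_mod_cast hN.symm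
  have hpN : ¬ p ∣ N := by
    rw [← hN']
    exact not_dvd_conductorNorm_of_hasGoodReductionAtPrime W hgood
  have hpD : ¬ (p : ℤ) ∣ NumberField.discr K :=
    not_dvd_discr_of_ncard_primesOver hprime (by rw [hK.1]; exact hsplit)
  have hΩpw : ((Ωpw : unrIntegers p) : ℂ_[p]) ≠ 0 := fun h0 ↦ by
    have h1 := (unrIntegers.isUnit_iff_norm_eq_one (Ωpw : unrIntegers p)).mp Ωpw.isUnit
    rw [h0, norm_zero] at h1
    exact zero_ne_one h1
  have hΩp' : ((Ωp' : unrIntegers p) : ℂ_[p]) ≠ 0 := fun h0 ↦ by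
    have h1 := (unrIntegers.isUnit_iff_norm_eq_one (Ωp' : unrIntegers p)).mp Ωp'.isUnit
    rw [h0, norm_zero] at h1
    exact zero_ne_one h1
  have hconc : Ideal.span {PowerSeries.map (Summit.BirchSwinnertonDyer.Rank1Residual.X11b.R1.unrToCpInt p) LW} =
      Ideal.span {PowerSeries.map (Summit.BirchSwinnertonDyer.Rank1Residual.X11b.R1.unrToCpInt p) L'} :=
    Summit.BirchSwinnertonDyer.BirchSwinnertonDyer.Theorems.SignedBaseChangeAcDivFrameConcordance.span_map_eq_of_isCWBDPLFunction_of_isBDPLFunction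
      hp2 hK hκ₂ hγ₂.out hpN hpD hΩKw hΩK' hΩpw hΩp' hLW hL'
  -- (4) descent to `R₀⟦T⟧`: `L' ∈ (L_W)`, i.e. `L' = u * L_W`
  have hL'mem : L' ∈ Ideal.span ({LW} : Set (UnrSeries p)) :=
    Summit.BirchSwinnertonDyer.Rank1Residual.X11b.unrSeries_mem_span_singleton_of_map_mem (by
      rw [hconc]
      exact Ideal.mem_span_singleton_self _)
  obtain ⟨u, hu⟩ := Ideal.mem_span_singleton'.mp hL'mem
  -- (5) the Castella-2018 frame `(Ω_K', Ω_p', L')` is the witness: `L' = u * L_W ∈ ch·R₀⟦T⟧`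
  refine ⟨ΩK', Ωp', L', hΩK', hL', fun j hj ↦ ?_⟩
  rw [← hu]
  exact Ideal.mul_mem_left _ u (hmemW j hj)

include hCWEulerHalfOn in
/-- **HOW ITSELF from the Castella–Wan-currency Euler half on a cell that is everything (kernel glue, no `sorry`; v5.4)** — the EXACT text of
`stub_howardIntegralSS`.  What it displays: the research residue of HOW is exactly «Castella–Wan Thm. A.5 + Thm. 6.8 at `N⁻ = 1` WITHOUT the hypothesis
"`N` squarefree" (used in print only for `G_ℚ ↠ Aut(E[p])`, a binder here) and at every class number (as printed)».  CONDITIONAL on the displayed shape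
hypothesis and on the cell being total.  Not a proof of the stub: the shape is a hypothesis.
[cite: CastellaWan2023, Thm. A.5 and its proof (MS pp. 35–36, esp. p. 36 L22–27 and footnote 5), Thm. 6.8 (MS pp. 29–31)] -/
theorem howardIntegralSS_of_cwEulerHalfOn_univ
    (hExtra : ∀ (W : WeierstrassCurve ℚ) (K : Type) [Field K] [NumberField K] (p N : ℕ), Extra W K p N) :
    SignedTwoVariableInputs → Literature.NumberTheory.EllipticCurves.ModularForms.nonempty_modularParametrizationData → ∀ (W : WeierstrassCurve ℚ) [W.IsElliptic] [W.IsGloballyMinimal] (p : ℕ) [Fact p.Prime], 5 ≤ p → W.HasGoodReductionAtPrime p → W.frobeniusTrace p = 0 → Literature.NumberTheory.EllipticCurves.Rank1Residual.Surj W p → ∀ (K : Type) [Field K] [NumberField K] (ι : PadicAlgCl p ≃+* ℂ) (v vbar : IsDedekindDomain.HeightOneSpectrum (NumberField.RingOfIntegers K)) (κ₁ κ₂ : Literature.NumberTheory.EllipticCurves.ZpExtension K p) (γ₁ γ₂ : Field.absoluteGaloisGroup K) [Fact (Literature.NumberTheory.EllipticCurves.ZpExtension.IsTopGeneratorPair κ₁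 κ₂ γ₁ γ₂)] [NeZero (NumberField.discr K).natAbs] (N : ℕ) [NeZero N] (f : CuspForm (CongruenceSubgroup.Gamma0 N) 2), Literature.NumberTheory.EllipticCurves.ModularForms.IsNewformOf W f → (N : ℤ) = W.conductorNorm ℤ → Literature.NumberTheory.EllipticCurves.IsImaginaryQuadratic K → ((Ideal.span {(p : ℤ)}).primesOver (NumberField.RingOfIntegers K)).ncard = 2 → ((p : ℕ) : NumberField.RingOfIntegers K) ∈ v.asIdeal → ((p : ℕ) : NumberField.RingOfIntegers K) ∈ vbar.asIdeal → vbar ≠ v → (∀ (w : NumberField.InfinitePlace K) (k : NumberField.RingOfIntegers K), k ∈ v.asIdeal ↔ ‖ι.symm (w.embedding (k : K))‖ < 1) → IsCoprime (N : ℤ) (NumberField.discr K) → (∀ ℓ : ℕ, ℓ.Prime → ℓ ∣ N → ((Ideal.span {(ℓ : ℤ)}).primesOver (NumberField.RingOfIntegers K)).ncard = 2) → Odd (NumberField.discr K) → NumberField.discr K ≠ -3 → κ₁.IsCyclotomic → κ₂.IsAnticyclotomic → (haveI : Fact (κ₂.IsTopGenerator γ₂) := ⟨Literature.NumberTheory.EllipticCurves.YanZhu2026.isTopGenerator_of_pair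 (κ₁ := κ₁) (γ₁ := γ₁)⟩; ∃ (ΩK : ℂ) (Ωp : (Literature.NumberTheory.EllipticCurves.unrIntegers p)ˣ) (L : Literature.NumberTheory.EllipticCurves.UnrSeries p), ΩK ≠ 0 ∧ Literature.NumberTheory.EllipticCurves.IsBDPLFunction ι v κ₂ γ₂ f ΩK ((Ωp : Literature.NumberTheory.EllipticCurves.unrIntegers p) : PadicComplex p) L ∧ ∀ j : ℤ_[p] →+* Literature.NumberTheory.EllipticCurves.unrIntegers p, (∀ x : ℤ_[p], ((j x : Literature.NumberTheory.EllipticCurves.unrIntegers p) : PadicComplex p) = algebraMap ℚ_[p] (PadicComplex p) (x : ℚ_[p])) → L ∈ (Literature.NumberTheory.EllipticCurves.Castella2018.AcSelmer.XAc.charIdeal (W.baseChange K) p κ₂ vbar ∅ γ₂).map (PowerSeries.map j)) := by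
  intro hIn hmodP W _ _ p _ hp hgood ha0 hs K _ _ ι v vbar κ₁ κ₂ γ₁ γ₂ _ _ N _ f hf hN hK hsplit hv hvbar hvv hι hcop hHeeg hodd hne3 hκ₁ hκ₂
  exact howardIntegralSS_on_of_cwEulerHalfOn Extra hCWEulerHalfOn hIn hmodP W p hp hgood ha0 hs K ι v vbar κ₁ κ₂ γ₁ γ₂ N f hf hN hK hsplit hv hvbar hvv hι hcop hHeeg hodd hne3 hκ₁ hκ₂ (hExtra W K p N)

/- SHAPE 4 (section hypothesis; nothing asserted) = TYPING WANT #6: the statement of the tree's `AcSigned.castellaWan2024_thmA5_thm68_bdp_mem_charIdeal`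
(its third, BDP-side conjunct) over `AcSigned.Setting₀` instead of `AcSigned.Setting` — i.e. WITHOUT `p ∤ h_K`, as printed (Castella–Wan's §6 standing
hypotheses, MS p. 25: «Let `E/ℚ` be an elliptic curve of conductor `N`, … `p > 3` a prime of good supersingular reduction for `E`, and `K` an imaginary
quadratic field satisfying hypotheses (gen-H) and (spl)»; Thm. A.5: «Assume that `N` is squarefree»; general `δ`: MS p. 18 L60–62, p. 25 L23–30).
[cite: CastellaWan2023, §6 standing hypotheses (MS p. 25), §4.1 (MS p. 18 L60–62), Thm. A.5 (MS pp. 35–36), Thm. 6.8 (MS pp. 29–31)] -/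
variable (hCWA5T68AnyClassNumber :
  ∀ (N : ℕ) [NeZero N] (W : WeierstrassCurve ℚ) [W.IsGloballyMinimal] (K : Type) [Field K] [NumberField K] (p : ℕ) [Fact p.Prime]
    (κ : ZpExtension K p) (𝔭 𝔭' : IsDedekindDomain.HeightOneSpectrum (NumberField.RingOfIntegers K)),
  ∀ (_ : AcSigned.Setting₀ W K p κ 𝔭 𝔭') (ι : PadicAlgCl p ≃+* ℂ) {f : CuspForm (CongruenceSubgroup.Gamma0 N) 2}
    (_ : ModularForms.IsNewformOf W f), (W.conductorNorm ℤ : ℕ) = N → SatisfiesHeegnerHypothesis N K →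
    3 < p → Squarefree N →
    (∀ (w : NumberField.InfinitePlace K) (k : NumberField.RingOfIntegers K), k ∈ 𝔭.asIdeal ↔ ‖ι.symm (w.embedding (k : K))‖ < 1) →
    ∀ (γ : Field.absoluteGaloisGroup K) [Fact (κ.IsTopGenerator γ)],
      ∃ (ΩK : ℂ) (Ωp : (unrIntegers p)ˣ) (L : UnrSeries p),
        ΩK ≠ 0 ∧
        CastellaWan2024.IsCWBDPLFunction ι 𝔭 κ γ f (NumberField.discr K) ΩK ((Ωp : unrIntegers p) : PadicComplex p) L ∧
        ∀ (j : ℤ_[p] →+* unrIntegers p),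
          (∀ x : ℤ_[p], ((j x : unrIntegers p) : PadicComplex p) = algebraMap ℚ_[p] (PadicComplex p) (x : ℚ_[p])) →
          L ∈ (Castella2018.AcSelmer.XAc.charIdeal (W.baseChange K) p κ 𝔭' ∅ γ).map (PowerSeries.map j))

include hCWA5T68AnyClassNumber in
/-- **HOW on the cell {`N` square-free} at EVERY class number (kernel glue, no `sorry`; v5.4)**: the text of `stub_howardIntegralSS` with the binder
`Squarefree N →` inserted after `κ₂.IsAnticyclotomic →`, FROM SHAPE 4 (typing want #6) through the cell glue at `Extra := (N square-free)`: the
`Setting₀` record is assembled from the crux's binders (`p ≠ 2` and `3 < p` from `5 ≤ p`; good supersingular from `HasGoodReductionAtPrime` and `a_p = 0`;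
`(W.conductorNorm ℤ : ℕ) = N` from `(N : ℤ) = W.conductorNorm ℤ`; (gen-H) at `N⁻ = 1` is the binder (Heeg)).  CONDITIONAL on the displayed shape hypothesis
(to be discharged by the ONE-def typing want #6; not by this file).
[cite: CastellaWan2023, Thm. A.5 (MS pp. 35–36), Thm. 6.8 (MS pp. 29–31), §4.1 (MS p. 18 L60–62)] -/
theorem howardIntegralSS_sqfree_of_cwA5T68AnyClassNumber :
    SignedTwoVariableInputs → Literature.NumberTheory.EllipticCurves.ModularForms.nonempty_modularParametrizationData → ∀ (W : WeierstrassCurve ℚ) [W.IsElliptic] [W.IsGloballyMinimal] (p : ℕ) [Fact p.Prime], 5 ≤ p → W.HasGoodReductionAtPrime p → W.frobeniusTrace p = 0 → Literature.NumberTheory.EllipticCurves.Rank1Residual.Surj W p → ∀ (K : Type) [Field K] [NumberField K] (ι : PadicAlgCl p ≃+* ℂ) (v vbar : IsDedekindDomain.HeightOneSpectrum (NumberField.RingOfIntegers K)) (κ₁ κ₂ : Literature.NumberTheory.EllipticCurves.ZpExtension K p) (γ₁ γ₂ : Field.absoluteGaloisGroup K) [Fact (Literature.NumberTheory.EllipticCurves.ZpExtension.IsTopGeneratorPair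 κ₁ κ₂ γ₁ γ₂)] [NeZero (NumberField.discr K).natAbs] (N : ℕ) [NeZero N] (f : CuspForm (CongruenceSubgroup.Gamma0 N) 2), Literature.NumberTheory.EllipticCurves.ModularForms.IsNewformOf W f → (N : ℤ) = W.conductorNorm ℤ → Literature.NumberTheory.EllipticCurves.IsImaginaryQuadratic K → ((Ideal.span {(p : ℤ)}).primesOver (NumberField.RingOfIntegers K)).ncard = 2 → ((p : ℕ) : NumberField.RingOfIntegers K) ∈ v.asIdeal → ((p : ℕ) : NumberField.RingOfIntegers K) ∈ vbar.asIdeal → vbar ≠ v → (∀ (w : NumberField.InfinitePlace K) (k : NumberField.RingOfIntegers K), k ∈ v.asIdeal ↔ ‖ι.symm (w.embedding (k : K))‖ < 1) → IsCoprime (N : ℤ) (NumberField.discr K) → (∀ ℓ : ℕ, ℓ.Prime → ℓ ∣ N → ((Ideal.span {(ℓ : ℤ)}).primesOver (NumberField.RingOfIntegers K)).ncard = 2) → Odd (NumberField.discr K) → NumberField.discr K ≠ -3 → κ₁.IsCyclotomic → κ₂.IsAnticyclotomic → Squarefree N → (haveI : Fact (κ₂.IsTopGenerator γ₂) := ⟨Literature.NumberTheory.EllipticCurves.YanZhu2026.isTopGenerator_of_pair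 (κ₁ := κ₁) (γ₁ := γ₁)⟩; ∃ (ΩK : ℂ) (Ωp : (Literature.NumberTheory.EllipticCurves.unrIntegers p)ˣ) (L : Literature.NumberTheory.EllipticCurves.UnrSeries p), ΩK ≠ 0 ∧ Literature.NumberTheory.EllipticCurves.IsBDPLFunction ι v κ₂ γ₂ f ΩK ((Ωp : Literature.NumberTheory.EllipticCurves.unrIntegers p) : PadicComplex p) L ∧ ∀ j : ℤ_[p] →+* Literature.NumberTheory.EllipticCurves.unrIntegers p, (∀ x : ℤ_[p], ((j x : Literature.NumberTheory.EllipticCurves.unrIntegers p) : PadicComplex p) = algebraMap ℚ_[p] (PadicComplex p) (x : ℚ_[p])) → L ∈ (Literature.NumberTheory.EllipticCurves.Castella2018.AcSelmer.XAc.charIdeal (W.baseChange K) p κ₂ vbar ∅ γ₂).map (PowerSeries.map j)) := by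
  intro hIn hmodP W _ _ p _ hp hgood ha0 hs K _ _ ι v vbar κ₁ κ₂ γ₁ γ₂ _ _ N _ f hf hN hK hsplit hv hvbar hvv hι hcop hHeeg hodd hne3 hκ₁ hκ₂ hsqf
  refine howardIntegralSS_on_of_cwEulerHalfOn (fun _ _ _ _ _ N ↦ Squarefree N) ?_ hIn hmodP W p hp hgood ha0 hs K ι v vbar κ₁ κ₂ γ₁ γ₂ N f hf hN hK hsplit hv hvbar hvv hι hcop hHeeg hodd hne3 hκ₁ hκ₂ hsqf
  intro p _ ι W _ _ K _ _ 𝔭 𝔭bar κ γ _ N _ f hf hN hp hgood ha0 hs hK hsplit h𝔭 hι h𝔭bar hne hHeeg hcop hκ hsq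
  have hS : AcSigned.Setting₀ W K p κ 𝔭 𝔭bar :=
    ⟨‹_›, by omega, ⟨hgood, by rw [ha0]; exact dvd_zero _⟩, ha0, hK, h𝔭, h𝔭bar, hne, hκ⟩
  have hN' : (W.conductorNorm ℤ : ℕ) = N := by exact_mod_cast hN.symm
  exact hCWA5T68AnyClassNumber N W K p κ 𝔭 𝔭bar hS ι hf hN' hHeeg (by omega) hsq hι γ

end CellC

/-! ## HOW on CELL C — CLOSED by the cite already in the tree (v5.4) -/

/-- **HOW on CELL C — CLOSED (v5.4, PURE-CITE; no shape hypothesis left)**: the text of `stub_howardIntegralSS` with the cell-C binders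
`¬ p ∣ NumberField.classNumber K →`, `Squarefree N →` inserted after `κ₂.IsAnticyclotomic →`, FROM conjunct (7) = the Literature named fact
`AcSigned.castellaWan2024_thmA5_thm68_bdp_mem_charIdeal` (Castella–Wan 2024 Thm. A.5 + Thm. 6.8, refereed, INTEGRAL, typed 2026-08-28) through the cell
glue `howardIntegralSS_on_of_cwEulerHalfOn` at `Extra := (p ∤ h_K ∧ N square-free)` (the `AcSigned.Setting` record assembled from the crux's binders and
`p ∤ h_K`).  Cell C ⊋ cell A (`howardIntegralSS_cellA_closed`, CHKLL25 Cor. 7.2: also «`E[p]` ramified at every `q ∣ N`») ∪ cell B (Lei–Zhao 2023 Thm. A,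
typing want #5 — now moot for HOW: also `p ∤ φ(N)`, `D_K` odd).  On cell C HOW is therefore PURE-CITE; the registered stub `stub_howardIntegralSS` (all `N`,
all `h_K`) stays ONE content stub with residual {`p ∣ h_K`} ∩ {`N` square-free} (refereed print, typing want #6) ∪ {`N` not square-free} (no print; the
printed proof with «squarefree ⟹ surjective» replaced by the binder `Surj`).  No summit statement, crux or registered stub is proved by this theorem;
BSD is not proved.
[cite: CastellaWan2023, Thm. A.5 (MS pp. 35–36), Thm. 6.8 (MS pp. 29–31), Prop. 2.1 (MS pp. 5–6), 5.2 (MS p. 23)]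
[cite: Castella2018, Thm. 3.1, Def. 2.2] [cite: BurungaleCastellaSkinner2025, Prop. 4.2.2] -/
theorem howardIntegralSS_cellC_closed :
    SignedTwoVariableInputs → Literature.NumberTheory.EllipticCurves.ModularForms.nonempty_modularParametrizationData → ∀ (W : WeierstrassCurve ℚ) [W.IsElliptic] [W.IsGloballyMinimal] (p : ℕ) [Fact p.Prime], 5 ≤ p → W.HasGoodReductionAtPrime p → W.frobeniusTrace p = 0 → Literature.NumberTheory.EllipticCurves.Rank1Residual.Surj W p → ∀ (K : Type) [Field K] [NumberField K] (ι : PadicAlgCl p ≃+* ℂ) (v vbar : IsDedekindDomain.HeightOneSpectrum (NumberField.RingOfIntegers K)) (κ₁ κ₂ : Literature.NumberTheory.EllipticCurves.ZpExtension K p) (γ₁ γ₂ : Field.absoluteGaloisGroup K) [Fact (Literature.NumberTheory.EllipticCurves.ZpExtension.IsTopGeneratorPair κ₁ κ₂ γ₁ γ₂)] [NeZero (NumberField.discr K).natAbs] (N : ℕ) [NeZero N] (f : CuspForm (CongruenceSubgroup.Gamma0 N) 2), Literature.NumberTheory.EllipticCurves.ModularForms.IsNewformOf W f → (N : ℤ)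 = W.conductorNorm ℤ → Literature.NumberTheory.EllipticCurves.IsImaginaryQuadratic K → ((Ideal.span {(p : ℤ)}).primesOver (NumberField.RingOfIntegers K)).ncard = 2 → ((p : ℕ) : NumberField.RingOfIntegers K) ∈ v.asIdeal → ((p : ℕ) : NumberField.RingOfIntegers K) ∈ vbar.asIdeal → vbar ≠ v → (∀ (w : NumberField.InfinitePlace K) (k : NumberField.RingOfIntegers K), k ∈ v.asIdeal ↔ ‖ι.symm (w.embedding (k : K))‖ < 1) → IsCoprime (N : ℤ) (NumberField.discr K) → (∀ ℓ : ℕ, ℓ.Prime → ℓ ∣ N → ((Ideal.span {(ℓ : ℤ)}).primesOver (NumberField.RingOfIntegers K)).ncard = 2) → Odd (NumberField.discr K) → NumberField.discr K ≠ -3 → κ₁.IsCyclotomic → κ₂.IsAnticyclotomic → ¬ p ∣ NumberField.classNumber K → Squarefree N → (haveI : Fact (κ₂.IsTopGenerator γ₂) := ⟨Literature.NumberTheory.EllipticCurves.YanZhu2026.isTopGenerator_of_pair (κ₁ := κ₁) (γ₁ := γ₁)⟩; ∃ (ΩK : ℂ) (Ωp : (Literature.NumberTheory.EllipticCurves.unrIntegers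 p)ˣ) (L : Literature.NumberTheory.EllipticCurves.UnrSeries p), ΩK ≠ 0 ∧ Literature.NumberTheory.EllipticCurves.IsBDPLFunction ι v κ₂ γ₂ f ΩK ((Ωp : Literature.NumberTheory.EllipticCurves.unrIntegers p) : PadicComplex p) L ∧ ∀ j : ℤ_[p] →+* Literature.NumberTheory.EllipticCurves.unrIntegers p, (∀ x : ℤ_[p], ((j x : Literature.NumberTheory.EllipticCurves.unrIntegers p) : PadicComplex p) = algebraMap ℚ_[p] (PadicComplex p) (x : ℚ_[p])) → L ∈ (Literature.NumberTheory.EllipticCurves.Castella2018.AcSelmer.XAc.charIdeal (W.baseChange K) p κ₂ vbar ∅ γ₂).map (PowerSeries.map j)) := by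
  intro hIn hmodP W _ _ p _ hp hgood ha0 hs K _ _ ι v vbar κ₁ κ₂ γ₁ γ₂ _ _ N _ f hf hN hK hsplit hv hvbar hvv hι hcop hHeeg hodd hne3 hκ₁ hκ₂ hh hsqf
  refine howardIntegralSS_on_of_cwEulerHalfOn (fun W K _ _ p N ↦ ¬ p ∣ NumberField.classNumber K ∧ Squarefree N) ?_ hIn hmodP W p hp hgood ha0 hs K ι v vbar κ₁ κ₂ γ₁ γ₂ N f hf hN hK hsplit hv hvbar hvv hι hcop hHeeg hodd hne3 hκ₁ hκ₂ ⟨hh, hsqf⟩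
  intro p _ ι W _ _ K _ _ 𝔭 𝔭bar κ γ _ N _ f hf hN hp hgood ha0 hs hK hsplit h𝔭 hι h𝔭bar hne hHeeg hcop hκ hX
  have hS : AcSigned.Setting W K p κ 𝔭 𝔭bar :=
    ⟨‹_›, by omega, ⟨hgood, by rw [ha0]; exact dvd_zero _⟩, ha0, hK, h𝔭, h𝔭bar, hne, hκ, hX.1⟩
  have hN' : (W.conductorNorm ℤ : ℕ) = N := by exact_mod_cast hN.symm
  exact (cite_cwA5T68 N W K p κ 𝔭 𝔭bar hS ι hf hN' hHeeg (by omega) hX.2 hι γ).2.2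

/-! ## LCD (PROVED in v4) and helpers (PROVED) -/

/-- LCD (LOCAL CONDITIONS DESCEND — PROVED in v4 by the LEAD bsd-line-sbc-p1 g3's landed exact-descent iff; renamed from `stub_localConditionsDescendSS` in v5, no longer a stub; arithmetic, local; text VERBATIM = bdpline v14's `stub_localConditionsDescendSS` (LEAD bsd-line-sbc-p1 g2,
pub/bsd-ssimc/bsd-line-sbc-p1/gen2/Lines_bdpline_v14_20727.lean; superseded THERE by the weaker (b₁) because 20727's rational S1 tolerates a torsion kernel —
an INTEGRAL `μ`-transfer does not)): **a class `y ∈ H¹(K_∞⁻, E[p^∞])` whose restriction to `K̃_∞` lies in the two-variable Greenberg group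
`H¹_{nr,v̄}(K̃_∞, E[p^∞])` lies in Castella's `Sel_v̄(K_∞⁻, E[p^∞]) = AcSelmer.selmerAc … ∅`.** Place by place: at `w ∤ p`, `K̃_∞/K_∞⁻` is unramified, and
unramified ⟹ locally trivial over `K_∞⁻,w` (split `ℓ ∣ N` finitely decomposed in the anticyclotomic tower with residual Galois group of order prime to `p`;
`Frob_w − 1` onto `E[p^∞]` at good `w`); at `v̄`: the local kernel `H¹(K̃_{∞,v̄}/K_{∞,v̄}⁻, E(K̃_{∞,v̄})[p^∞])` vanishes because a supersingular curve (`a_p = 0`,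
`p ≥ 5`) has no `p`-power torsion over `ℚ_p^{ab}·ℚ_p^{nr}` (Serre 1972 §1.11 Prop. 12: level-2 fundamental characters), and unramified-at-`v̄` upstairs is
already strict by (V) (PROVED: p620980 + p618705). PROOF ROUTE FROM TREE BRICKS (all PROVED; = the LEAD g3's (b₁) plan 10:05Z with `t = 1`):
(i) `∞`: `decompInf_eq_bot_of_isComplex`; (ii) `w ∤ p` finitely decomposed in `K_∞⁻` (every `w ∣ N`: split in `K` by (Heeg), then Brink 2007
`ZpExtension.decomp_not_le_kerSubgroup_of_isAnticyclotomic_holds`; and every good split `w`): `I_w ≤ pairKer` (`ZpExtension.inertia_le_kerSubgroup_holds`) so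
unramified descends verbatim, then `EisensteinPrimes….unramifiedKer_le_awayKer_of_not_decomp_le` (unramified ⟹ locally trivial, `D_w/I_w` pro-`p′` upstairs);
(iii) good `w ∤ p` with `D_w ≤ ker κ₂` (inert `ℓ`): unramified ⟹ class in `E[p^∞]/(Frob_w − 1) = 0` (`φ − 1` onto a divisible module; utd-p1 brick
`resOfLe_injective_of_frobenius_generation` / cn100 `card_fixedPoints_nsmul_eq_zero_…`); bad inert `w`: excluded by (Heeg); (iv) `v̄`: inflation-restriction along
`K̃_{∞,v̄}/K⁻_{∞,v̄}` with `E(K̃_{∞,v̄})[p^∞] ⊆ E[p^∞]^{pairKer ⊓ I_v̄} = 0` ((V), Serre) and unramified = strict upstairs by (V) again; (v) `v`: relaxed on both sides.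
WHY IT MIGHT FAIL: at ordinary `p` the `v̄`-kernel can be non-zero (anomalous primes) — the stub is only asserted at `a_p = 0`; at supersingular `p` only a
mismatch between the tree's `bdpData`/`unrSelmer₂` local conditions and the printed ones (Castella 2018 Def. 2.2) could break it. Print shape: Castella–Wan
(arXiv:1607.02019) proof of Thm 6.1; Skinner–Urban 2014 Prop. 3.2.8 (local half); Greenberg LNM 1716 §2–§3. -/
theorem localConditionsDescendSS :
    SignedTwoVariableInputs → Literature.NumberTheory.EllipticCurves.ModularForms.nonempty_modularParametrizationData → ∀ (W : WeierstrassCurve ℚ) [W.IsElliptic] [W.IsGloballyMinimal] (p : ℕ) [Fact p.Prime], 5 ≤ p → W.HasGoodReductionAtPrime p → W.frobeniusTrace p = 0 → Literature.NumberTheory.EllipticCurves.Rank1Residual.Surj W p → ∀ (K : Type) [Field K] [NumberField K] (ι : PadicAlgCl p ≃+* ℂ) (v vbar : IsDedekindDomain.HeightOneSpectrum (NumberField.RingOfIntegers K)) (κ₁ κ₂ : Literature.NumberTheory.EllipticCurves.ZpExtension K p) (γ₁ γ₂ : Field.absoluteGaloisGroup K) [Fact (Literature.NumberTheory.EllipticCurves.ZpExtension.IsTopGeneratorPair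 κ₁ κ₂ γ₁ γ₂)] [NeZero (NumberField.discr K).natAbs] (N : ℕ) [NeZero N] (f : CuspForm (CongruenceSubgroup.Gamma0 N) 2), Literature.NumberTheory.EllipticCurves.ModularForms.IsNewformOf W f → (N : ℤ) = W.conductorNorm ℤ → Literature.NumberTheory.EllipticCurves.IsImaginaryQuadratic K → ((Ideal.span {(p : ℤ)}).primesOver (NumberField.RingOfIntegers K)).ncard = 2 → ((p : ℕ) : NumberField.RingOfIntegers K) ∈ v.asIdeal → ((p : ℕ) : NumberField.RingOfIntegers K) ∈ vbar.asIdeal → vbar ≠ v → (∀ (w : NumberField.InfinitePlace K) (k : NumberField.RingOfIntegers K), k ∈ v.asIdeal ↔ ‖ι.symm (w.embedding (k : K))‖ < 1) → IsCoprime (N : ℤ) (NumberField.discr K) → (∀ ℓ : ℕ, ℓ.Prime → ℓ ∣ N → ((Ideal.span {(ℓ : ℤ)}).primesOver (NumberField.RingOfIntegers K)).ncard = 2) → Odd (NumberField.discr K) → NumberField.discr K ≠ -3 → κ₁.IsCyclotomic → κ₂.IsAnticyclotomic → ∀ y : (W.baseChange K).subgroupH1 p κ₂.kerSubgroup, (W.baseChange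 K).resOfLe p (Literature.NumberTheory.EllipticCurves.ZpExtension.pairKer_le_right κ₁ κ₂) y ∈ Literature.NumberTheory.EllipticCurves.unrSelmer₂ κ₁ κ₂ (WeierstrassCurve.geomPrimaryTorsion (W.baseChange K) p) vbar → y ∈ Literature.NumberTheory.EllipticCurves.Castella2018.AcSelmer.selmerAc (W.baseChange K) p κ₂ vbar ∅ := by
  -- PROVED (v4): the LEAD's landed exact-descent iff, forward direction (`SatisfiesHeegnerHypothesis N K` is definitionally the binder `hHeeg`).
  intro hIn hMP W _ _ p _ hp hgood hap hsurj K _ _ ι v vbar κ₁ κ₂ γ₁ γ₂ _ _ N _ f hf hN hK hsplit hv hvbar hne hιv hcop hHeeg hodd hm3 hcyc hac y hy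
  have hp2 : p ≠ 2 := by omega
  have hap' : (p : ℤ) ∣ W.frobeniusTrace p := by rw [hap]; exact dvd_zero _
  have hN' : W.conductorNorm ℤ = N := by exact_mod_cast hN.symm
  exact (Summit.BirchSwinnertonDyer.BirchSwinnertonDyer.Theorems.SignedBaseChangeAcDivAwayDiscrepancy.resOfLe_mem_unrSelmer₂_iff_mem_selmerAc_of_heegner
    W K p hp2 hgood hap' hK hN' hHeeg hv hvbar hne hcyc κ₂ hac y).mp hy


/-! ## Helpers (proved) -/

/-- Over a local ring, if `h * g` has a unit coefficient then so does `g` (reduce modulo the maximal ideal). -/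
theorem hasUnitContent_of_mul_left {R : Type*} [CommRing R] [IsLocalRing R] {h g : PowerSeries R}
    (hhg : GreenbergVatsal2000.HasUnitContent (h * g)) : GreenbergVatsal2000.HasUnitContent g := by
  rw [hasUnitContent_iff_map_residue_ne_zero] at hhg ⊢
  rw [map_mul] at hhg
  exact right_ne_zero_of_mul hhg

/-- **Herbrand specialisation, DIVISIBILITY form** (no `X[T₁] = 0` / no-pseudo-null input): for a finitely generated `Λ₂ = ℤ_p⟦T₂⟧⟦T₁⟧`-module `M` killed by
some `s` with `s(0) ≠ 0`, `ch_{Λ₁}(M/T₁M) ≤ π(ch_{Λ₂}(M))` for the constants `Λ₁`-structure — immediate from the tree's PROVED full Herbrand formula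
`PowerSeriesSpecialization.charIdeal_quotSMulTop_eq_mul` (`ch(M/T₁M) = ch(M[T₁]) · π(ch M)`; Bourbaki AC VII §4.5, SU14 Cor. 3.2.9). [folklore] -/
theorem charIdeal_quotSMulTop_le_map (p : ℕ) [Fact p.Prime] (M : Type*) [AddCommGroup M]
    [Module (PowerSeries (IwasawaAlgebra p)) M] [Module.Finite (PowerSeries (IwasawaAlgebra p)) M]
    (hs : ∃ s : PowerSeries (IwasawaAlgebra p), PowerSeries.constantCoeff s ≠ 0 ∧ ∀ m : M, s • m = 0) :
    letI : Module (IwasawaAlgebra p) (QuotSMulTop (PowerSeries.X : PowerSeries (IwasawaAlgebra p)) M) :=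
      Module.compHom _ (PowerSeries.C (R := IwasawaAlgebra p))
    charIdeal (IwasawaAlgebra p) (QuotSMulTop (PowerSeries.X : PowerSeries (IwasawaAlgebra p)) M) ≤
      (charIdeal (PowerSeries (IwasawaAlgebra p)) M).map (PowerSeries.constantCoeff (R := IwasawaAlgebra p)) := by
  haveI : UniqueFactorizationMonoid (PowerSeries (IwasawaAlgebra p)) :=
    Literature.NumberTheory.IwasawaTheory.uniqueFactorizationMonoid_iwasawaAlgebraTwoVar p
  let alg : Algebra (IwasawaAlgebra p) (PowerSeries (IwasawaAlgebra p)) :=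
    @MvPowerSeries.instAlgebra Unit (IwasawaAlgebra p) (IwasawaAlgebra p) _ _ (Algebra.id _)
  letI : Module (IwasawaAlgebra p) M := Module.compHom M (PowerSeries.C (R := IwasawaAlgebra p))
  have hIST : @IsScalarTower (IwasawaAlgebra p) (PowerSeries (IwasawaAlgebra p)) M alg.toSMul
      inferInstance inferInstance :=
    @IsScalarTower.mk _ _ _ alg.toSMul _ _ fun a r m => by
      rw [@Algebra.smul_def _ _ _ _ alg a r, mul_smul]
      rfl
  have h := @PowerSeriesSpecialization.charIdeal_quotSMulTop_eq_mul (IwasawaAlgebra p) _ _ _ _ _ M _ _ _ _ hIST hs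
  exact h.le.trans Ideal.mul_le_left


/-- **`R₀ = 𝓞(\widehat{ℚ_p^ur}) ⊂ ℂ_p` is a local ring**: its units are its norm-one elements (`unrIntegers.isUnit_iff_norm_eq_one`), every element has
norm `≤ 1`, and the non-units (norm `< 1`) are closed under addition by the ultrametric inequality. [cite: SerreLocalFields1979, Ch. II §5, Thm. 3] -/
theorem isLocalRing_unrIntegers (p : ℕ) [Fact p.Prime] : IsLocalRing (unrIntegers p) := by
  refine IsLocalRing.of_nonunits_add ?_
  intro a b ha hb
  rw [mem_nonunits_iff, unrIntegers.isUnit_iff_norm_eq_one] at ha hb ⊢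
  have ha' : ‖(a : ℂ_[p])‖ < 1 :=
    lt_of_le_of_ne (Summit.BirchSwinnertonDyer.Rank1Residual.X11b.Halves.norm_le_one_of_mem_unrIntegers p a.2) ha
  have hb' : ‖(b : ℂ_[p])‖ < 1 :=
    lt_of_le_of_ne (Summit.BirchSwinnertonDyer.Rank1Residual.X11b.Halves.norm_le_one_of_mem_unrIntegers p b.2) hb
  have hab : ‖((a + b : unrIntegers p) : ℂ_[p])‖ < 1 := by
    rw [Subring.coe_add]
    exact (IsUltrametricDist.norm_add_le_max _ _).trans_lt (max_lt ha' hb')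
  exact hab.ne

/-- **Units descend along a structure-compatible `j : ℤ_p → R₀`**: `j a ∈ R₀ˣ ⟹ a ∈ ℤ_pˣ` (both unit groups are the norm-one elements and `j`
preserves the norm of `ℂ_p`). [folklore] -/
theorem isUnit_of_isUnit_ringHom_unrIntegers {p : ℕ} [Fact p.Prime] {j : ℤ_[p] →+* unrIntegers p}
    (hj : ∀ x : ℤ_[p], ((j x : unrIntegers p) : ℂ_[p]) = algebraMap ℚ_[p] ℂ_[p] (x : ℚ_[p])) {a : ℤ_[p]}
    (ha : IsUnit (j a)) : IsUnit a := by
  rw [unrIntegers.isUnit_iff_norm_eq_one, hj, norm_algebraMap'] at ha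
  rw [PadicInt.isUnit_iff, PadicInt.norm_def]
  exact ha

/-- **Unit content descends along `j : ℤ_p → R₀`.** [folklore] -/
theorem hasUnitContent_of_map_ringHom_unrIntegers {p : ℕ} [Fact p.Prime] {j : ℤ_[p] →+* unrIntegers p}
    (hj : ∀ x : ℤ_[p], ((j x : unrIntegers p) : ℂ_[p]) = algebraMap ℚ_[p] ℂ_[p] (x : ℚ_[p])) {c : IwasawaAlgebra p}
    (hc : GreenbergVatsal2000.HasUnitContent (PowerSeries.map j c)) : GreenbergVatsal2000.HasUnitContent c := by
  obtain ⟨n, hn⟩ := hc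
  rw [PowerSeries.coeff_map] at hn
  exact ⟨n, isUnit_of_isUnit_ringHom_unrIntegers hj hn⟩

/-! ## Derived input (no sorry): MU0 from HOW + Hsieh/BCS `μ(L_p^BDP) = 0` + integral cross-period rigidity -/

/-- **MU0 closed (MIXED → HOW)**: v4's `stub_xAcMuZeroSS` text — at a good supersingular `p ≥ 5`, `(spl)`, classical Heegner, `Surj`:
**`ch_Λ(X_ac)` contains a power series of unit content** (`μ(X_ac) = 0`).  PROOF: HOW gives a frame `(Ω_K, Ω_p, L)` with `L ∈ ch_Λ(X_ac)·R₀⟦T⟧`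
along every compatible `j`; conjunct (4) (BCS25 Prop 4.2.2 / Hsieh Thm B, (irr_K) from `Surj`) gives a frame `(Ω_K′, Ω_p′, L′)` with a UNIT
coefficient; integral cross-period rigidity (`UniversalToricDescentTwinSplit.span_singleton_eq_of_isBDPLFunction`, any periods) gives `(L′) = (L)`,
so `L′ = h′·L`; a compatible `j` exists (`exists_ringHom_padicInt_unrIntegers`); `ch_Λ(X_ac) = (c)` is principal (`charIdeal_isPrincipal_holds`), so
`L = h·j(c)` and `L′ = h′·h·j(c)` has unit content; `R₀` is local, hence `j(c)` has unit content (`hasUnitContent_of_mul_left`), hence so has `c`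
(`hasUnitContent_of_map_ringHom_unrIntegers`).  [cite: BurungaleCastellaSkinner2025, Prop. 4.2.2] [cite: Hsieh2014, Thm. B]
[cite: Castella2018, Thm. 3.1] [cite: CastellaCiperianiSkinnerSprung2018, Thm. 5.7, Lemma 5.5] -/
theorem xAcMuZeroSS_closed :
    SignedTwoVariableInputs → Literature.NumberTheory.EllipticCurves.ModularForms.nonempty_modularParametrizationData → ∀ (W : WeierstrassCurve ℚ) [W.IsElliptic] [W.IsGloballyMinimal] (p : ℕ) [Fact p.Prime], 5 ≤ p → W.HasGoodReductionAtPrime p → W.frobeniusTrace p = 0 → Literature.NumberTheory.EllipticCurves.Rank1Residual.Surj W p → ∀ (K : Type) [Field K] [NumberField K] (ι : PadicAlgCl p ≃+* ℂ) (v vbar : IsDedekindDomain.HeightOneSpectrum (NumberField.RingOfIntegers K)) (κ₁ κ₂ : Literature.NumberTheory.EllipticCurves.ZpExtension K p) (γ₁ γ₂ : Field.absoluteGaloisGroup K) [Fact (Literature.NumberTheory.EllipticCurves.ZpExtension.IsTopGeneratorPair κ₁ κ₂ γ₁ γ₂)] [NeZero (NumberField.discr K).natAbs] (N : ℕ) [NeZero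 N] (f : CuspForm (CongruenceSubgroup.Gamma0 N) 2), Literature.NumberTheory.EllipticCurves.ModularForms.IsNewformOf W f → (N : ℤ) = W.conductorNorm ℤ → Literature.NumberTheory.EllipticCurves.IsImaginaryQuadratic K → ((Ideal.span {(p : ℤ)}).primesOver (NumberField.RingOfIntegers K)).ncard = 2 → ((p : ℕ) : NumberField.RingOfIntegers K) ∈ v.asIdeal → ((p : ℕ) : NumberField.RingOfIntegers K) ∈ vbar.asIdeal → vbar ≠ v → (∀ (w : NumberField.InfinitePlace K) (k : NumberField.RingOfIntegers K), k ∈ v.asIdeal ↔ ‖ι.symm (w.embedding (k : K))‖ < 1) → IsCoprime (N : ℤ) (NumberField.discr K) → (∀ ℓ : ℕ, ℓ.Prime → ℓ ∣ N → ((Ideal.span {(ℓ : ℤ)}).primesOver (NumberField.RingOfIntegers K)).ncard = 2) → Odd (NumberField.discr K) → NumberField.discr K ≠ -3 → κ₁.IsCyclotomic → κ₂.IsAnticyclotomic → (haveI : Fact (κ₂.IsTopGenerator γ₂) := ⟨Literature.NumberTheory.EllipticCurves.YanZhu2026.isTopGenerator_of_pair (κ₁ := κ₁) (γ₁ := γ₁)⟩;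 ∃ g ∈ Literature.NumberTheory.EllipticCurves.Castella2018.AcSelmer.XAc.charIdeal (W.baseChange K) p κ₂ vbar ∅ γ₂, Literature.NumberTheory.EllipticCurves.GreenbergVatsal2000.HasUnitContent g) := by
  intro hIn hmodP W _ _ p _ hp hgood ha0 hs K _ _ ι v vbar κ₁ κ₂ γ₁ γ₂ _ _ N _ f hf hN hK hsplit hv hvbar hvv hι hcop hHeeg hodd
    hne3 hκ₁ hκ₂
  haveI hγ₂ : Fact (κ₂.IsTopGenerator γ₂) := ⟨YanZhu2026.isTopGenerator_of_pair (κ₁ := κ₁) (γ₁ := γ₁)⟩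
  haveI : IsLocalRing (unrIntegers p) := isLocalRing_unrIntegers p
  have hirr : (W.baseChange K).HasIrreducibleModPGaloisRep p :=
    Summit.BirchSwinnertonDyer.Rank1Residual.irrK_of_surj W p hs K hK.1
  -- (1) HOW: an integral frame `(ΩK, Ωp, L)`
  obtain ⟨ΩK, Ωp, L, hΩK, hL, hmem⟩ := stub_howardIntegralSS hIn hmodP W p hp hgood ha0 hs K ι v vbar κ₁ κ₂ γ₁ γ₂ N f hf hN hK
    hsplit hv hvbar hvv hι hcop hHeeg hodd hne3 hκ₁ hκ₂
  -- (2) BCS25 Prop 4.2.2 / Hsieh Thm B: a frame `(ΩK', Ωp', L')` with a unit coefficient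
  obtain ⟨ΩK', Ωp', L', hΩK', hL', k, hk⟩ := cite_prop422 ι W K v κ₂ γ₂ hf (by omega) hgood hK hHeeg hsplit hodd hne3 hirr hv
    hι hκ₂ hγ₂.out
  -- (3) integral cross-period rigidity: `(L') = (L)`, so `L' = h' * L`
  have hΩp : ((Ωp : unrIntegers p) : ℂ_[p]) ≠ 0 := fun h0 ↦ by
    have h1 := (unrIntegers.isUnit_iff_norm_eq_one (Ωp : unrIntegers p)).mp Ωp.isUnit
    rw [h0, norm_zero] at h1
    exact zero_ne_one h1
  have hΩp' : ((Ωp' : unrIntegers p) : ℂ_[p]) ≠ 0 := fun h0 ↦ by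
    have h1 := (unrIntegers.isUnit_iff_norm_eq_one (Ωp' : unrIntegers p)).mp Ωp'.isUnit
    rw [h0, norm_zero] at h1
    exact zero_ne_one h1
  have hspan := Summit.BirchSwinnertonDyer.BirchSwinnertonDyer.Theorems.UniversalToricDescentTwinSplit.span_singleton_eq_of_isBDPLFunction
    hK hκ₂ hγ₂.out hΩK hΩK' hΩp hΩp' hL hL'
  have hL'mem : L' ∈ Ideal.span ({L} : Set (UnrSeries p)) := by
    rw [← hspan]
    exact Ideal.mem_span_singleton_self L'
  obtain ⟨h', hh'⟩ := Ideal.mem_span_singleton'.mp hL'mem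
  -- (4) a structure map `j` and a principal generator `c` of `ch_Λ(X_ac)`
  obtain ⟨j, hj⟩ := Literature.NumberTheory.EllipticCurves.exists_ringHom_padicInt_unrIntegers p
  obtain ⟨c, hc⟩ :=
    (Literature.NumberTheory.EllipticCurves.charIdeal_isPrincipal_holds p
      (Castella2018.AcSelmer.XAc (W.baseChange K) p κ₂ vbar ∅ γ₂)).principal
  have hch : Castella2018.AcSelmer.XAc.charIdeal (W.baseChange K) p κ₂ vbar ∅ γ₂ = Ideal.span {c} := hc
  have hLmem : L ∈ Ideal.span {PowerSeries.map j c} := by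
    have h1 := hmem j hj
    rw [hch, Ideal.map_span, Set.image_singleton] at h1
    exact h1
  obtain ⟨h, hh⟩ := Ideal.mem_span_singleton'.mp hLmem
  -- (5) `L' = h' * h * j(c)` has unit content, hence so has `j(c)` (`R₀` local), hence so has `c`
  have hL'u : GreenbergVatsal2000.HasUnitContent L' := ⟨k, hk⟩
  rw [← hh', ← hh, ← mul_assoc] at hL'u
  have hcj : GreenbergVatsal2000.HasUnitContent (PowerSeries.map j c) := hasUnitContent_of_mul_left hL'u
  exact ⟨c, by rw [hch]; exact Ideal.mem_span_singleton_self c, hasUnitContent_of_map_ringHom_unrIntegers hj hcj⟩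

/-! ## Derived input (no sorry): EXACT anticyclotomic control from LCD + the landed global/duality halves -/

/-- **Exact control `X_Gr₂/T₁X_Gr₂ ≅ X_ac`** (`Λ₁`-linear bijection for the constants structure; v2's `stub_controlExactSS`, now DERIVED): restriction
`Sel_v̄(K_∞⁻) → H¹_{nr,v̄}(K̃_∞)^{γ₁ = 1}` is onto — GLOBAL half = p617259 `exists_resOfLe_eq_of_conjH1_eq_pair_geomPrimaryTorsion` (`E(K)[p] = 0` from Surj via
`torsionBy_eq_bot_of_isImaginaryQuadratic`), LOCAL half = stub LCD (exactly bdpline v14's `stub_resOntoInvariantsSS` derivation); injectivity of `toXAcQuot` by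
Pontryagin duality (p615993 `XGr₂.toXAcQuot_injective_of_forall_mem_range`); surjectivity `XGr₂.toXAcQuot_surjective`; `Λ₁`-linear packaging as in p567002. -/
theorem controlExactSS :
    SignedTwoVariableInputs → Literature.NumberTheory.EllipticCurves.ModularForms.nonempty_modularParametrizationData → ∀ (W : WeierstrassCurve ℚ) [W.IsElliptic] [W.IsGloballyMinimal] (p : ℕ) [Fact p.Prime], 5 ≤ p → W.HasGoodReductionAtPrime p → W.frobeniusTrace p = 0 → Literature.NumberTheory.EllipticCurves.Rank1Residual.Surj W p → ∀ (K : Type) [Field K] [NumberField K] (ι : PadicAlgCl p ≃+* ℂ) (v vbar : IsDedekindDomain.HeightOneSpectrum (NumberField.RingOfIntegers K)) (κ₁ κ₂ : Literature.NumberTheory.EllipticCurves.ZpExtension K p) (γ₁ γ₂ : Field.absoluteGaloisGroup K) [Fact (Literature.NumberTheory.EllipticCurves.ZpExtension.IsTopGeneratorPair κ₁ κ₂ γ₁ γ₂)] [NeZero (NumberField.discr K).natAbs] (N : ℕ) [NeZero N] (f : CuspForm (CongruenceSubgroup.Gamma0 N) 2), Literature.NumberTheory.EllipticCurves.ModularForms.IsNewformOf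 W f → (N : ℤ) = W.conductorNorm ℤ → Literature.NumberTheory.EllipticCurves.IsImaginaryQuadratic K → ((Ideal.span {(p : ℤ)}).primesOver (NumberField.RingOfIntegers K)).ncard = 2 → ((p : ℕ) : NumberField.RingOfIntegers K) ∈ v.asIdeal → ((p : ℕ) : NumberField.RingOfIntegers K) ∈ vbar.asIdeal → vbar ≠ v → (∀ (w : NumberField.InfinitePlace K) (k : NumberField.RingOfIntegers K), k ∈ v.asIdeal ↔ ‖ι.symm (w.embedding (k : K))‖ < 1) → IsCoprime (N : ℤ) (NumberField.discr K) → (∀ ℓ : ℕ, ℓ.Prime → ℓ ∣ N → ((Ideal.span {(ℓ : ℤ)}).primesOver (NumberField.RingOfIntegers K)).ncard = 2) → Odd (NumberField.discr K) → NumberField.discr K ≠ -3 → κ₁.IsCyclotomic → κ₂.IsAnticyclotomic → (letI : Module (Literature.NumberTheory.EllipticCurves.IwasawaAlgebra p) (QuotSMulTop (PowerSeries.X : Literature.NumberTheory.EllipticCurves.IwasawaAlgebra₂ p) ((W.baseChange K).XGr₂ p κ₁ κ₂ vbar γ₁ γ₂)) := Module.compHom _ (PowerSeries.C (R := Literature.NumberTheory.EllipticCurves.IwasawaAlgebra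 p)); haveI : Fact (κ₂.IsTopGenerator γ₂) := ⟨Literature.NumberTheory.EllipticCurves.YanZhu2026.isTopGenerator_of_pair (κ₁ := κ₁) (γ₁ := γ₁)⟩; ∃ f : QuotSMulTop (PowerSeries.X : Literature.NumberTheory.EllipticCurves.IwasawaAlgebra₂ p) ((W.baseChange K).XGr₂ p κ₁ κ₂ vbar γ₁ γ₂) →ₗ[Literature.NumberTheory.EllipticCurves.IwasawaAlgebra p] Literature.NumberTheory.EllipticCurves.Castella2018.AcSelmer.XAc (W.baseChange K) p κ₂ vbar ∅ γ₂, Function.Bijective f) := by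
  intro hIn hmodP W _ _ p _ hp hgood ha0 hs K _ _ ι v vbar κ₁ κ₂ γ₁ γ₂ _ _ N _ f hf hN hK hsplit hv hvbar hvv hι hcop hHeeg hodd
    hne3 hκ₁ hκ₂
  haveI hγ₂ : Fact (κ₂.IsTopGenerator γ₂) := ⟨YanZhu2026.isTopGenerator_of_pair (κ₁ := κ₁) (γ₁ := γ₁)⟩
  have hp2 : p ≠ 2 := by omega
  have htor := Literature.NumberTheory.EllipticCurves.torsionBy_eq_bot_of_isImaginaryQuadratic W K hK (Fact.out) hp2 hs
  have hKp : ∀ P : (W.baseChange K).toAffine.Point, p • P = 0 → P = 0 := fun P hP ↦ by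
    have hmem : P ∈ AddSubgroup.torsionBy (W.baseChange K).toAffine.Point (p : ℤ) :=
      AddSubgroup.torsionBy.nsmul_iff.mpr hP
    rw [htor] at hmem
    exact AddSubgroup.mem_bot.mp hmem
  have hpair : ZpExtension.IsTopGeneratorPair κ₁ κ₂ γ₁ γ₂ := Fact.out
  haveI : (W.baseChange K).IsElliptic := by rw [WeierstrassCurve.baseChange]; infer_instance
  -- (i) restriction onto the `γ₁`-fixed classes: GLOBAL half landed, LOCAL half = LCD
  have honto : ∀ s : unrSelmer₂ κ₁ κ₂ (WeierstrassCurve.geomPrimaryTorsion (W.baseChange K) p) vbar,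
      conjSel₂ κ₁ κ₂ (WeierstrassCurve.geomPrimaryTorsion (W.baseChange K) p) vbar γ₁ s = s →
        s ∈ Set.range ((W.baseChange K).selmerAcToUnrSelmer₂ p κ₁ κ₂ vbar) := by
    intro s hs1
    have hx : (W.baseChange K).conjH1 p (ZpExtension.pairKer κ₁ κ₂) γ₁
        (s : (W.baseChange K).subgroupH1 p (ZpExtension.pairKer κ₁ κ₂)) = s := by
      rw [← coe_conjSel₂_apply, hs1]
    obtain ⟨y, hy⟩ :=
      Summit.BirchSwinnertonDyer.BirchSwinnertonDyer.Theorems.SignedBaseChangeAcDivExactControl.exists_resOfLe_eq_of_conjH1_eq_pair_geomPrimaryTorsion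
        (W.baseChange K) hpair hKp _ hx
    have hySel : y ∈ Castella2018.AcSelmer.selmerAc (W.baseChange K) p κ₂ vbar ∅ :=
      localConditionsDescendSS hIn hmodP W p hp hgood ha0 hs K ι v vbar κ₁ κ₂ γ₁ γ₂ N f hf hN hK hsplit hv hvbar hvv hι hcop hHeeg hodd hne3 hκ₁ hκ₂ y (by rw [hy]; exact s.2)
    refine ⟨⟨y, hySel⟩, Subtype.ext ?_⟩
    rw [WeierstrassCurve.coe_selmerAcToUnrSelmer₂_apply]
    exact hy
  -- (ii) injectivity by Pontryagin duality, surjectivity, `Λ₁`-linear packaging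
  have hinj := WeierstrassCurve.XGr₂.toXAcQuot_injective_of_forall_mem_range (W.baseChange K) p κ₁ κ₂ vbar γ₁ γ₂ honto
  let e : QuotSMulTop (PowerSeries.X : IwasawaAlgebra₂ p) ((W.baseChange K).XGr₂ p κ₁ κ₂ vbar γ₁ γ₂)
      ≃ₗ[IwasawaAlgebra₂ p] (((W.baseChange K).XGr₂ p κ₁ κ₂ vbar γ₁ γ₂) ⧸
        (Ideal.span {(PowerSeries.X : IwasawaAlgebra₂ p)} •
          (⊤ : Submodule (IwasawaAlgebra₂ p) ((W.baseChange K).XGr₂ p κ₁ κ₂ vbar γ₁ γ₂)))) :=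
    Submodule.quotEquivOfEq _ _
      (Submodule.ideal_span_singleton_smul (PowerSeries.X : IwasawaAlgebra₂ p) ⊤).symm
  let ψ := (WeierstrassCurve.XGr₂.toXAcQuot (W.baseChange K) p κ₁ κ₂ vbar γ₁ γ₂).comp e.toLinearMap
  have hψs : Function.Surjective ψ :=
    (WeierstrassCurve.XGr₂.toXAcQuot_surjective (W.baseChange K) p κ₁ κ₂ vbar γ₁ γ₂ hKp).comp e.surjective
  have hψi : Function.Injective ψ := hinj.comp e.injective
  letI : Module (IwasawaAlgebra p) (QuotSMulTop (PowerSeries.X : IwasawaAlgebra₂ p) ((W.baseChange K).XGr₂ p κ₁ κ₂ vbar γ₁ γ₂)) :=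
    Module.compHom _ (PowerSeries.C (R := IwasawaAlgebra p))
  refine ⟨{ toFun := ψ
            map_add' := ψ.map_add
            map_smul' := fun a q => ?_ }, hψi, hψs⟩
  show ψ ((PowerSeries.C a : IwasawaAlgebra₂ p) • q) = a • ψ q
  rw [ψ.map_smulₛₗ, PowerSeries.constantCoeff_C]


/-! ## The composition: the crux BY NAME (dichotomy ordinary / supersingular at `p ≥ 5`) -/

/-- **`TwoVariableEulerSystemDivisibility` from the three v5.3 stubs** (cite · HOW · F1; through `ordSliceES_closed`, `xAcTorsionSS_closed` (PURE-CITE since v5.3), `xAcMuZeroSS_closed` and F1). Ordinary: ORD (PURE-CITE). Supersingular: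
rational inclusion (F1) + `μ(c⁻) = 0`, the latter from TS1 + MU0 (HOW + Hsieh + rigidity) + exact control (derived from LCD) + Herbrand divisibility (tree); then
`p`-power cancellation (tree). -/
theorem TwoVariableEulerSystemDivisibility_of :
    Summit.BirchSwinnertonDyer.BirchSwinnertonDyer.Theses.SignedBaseChange.TwoVariableEulerSystemDivisibility := by
  intro hIn hmodP W _ _ p _ hp hgood hs K _ _ ι v vbar κ₁ κ₂ γ₁ γ₂ _ _ N _ f hf hN hK hsplit hv hvbar hvv hι hcop hHeeg hodd
    hne3 hκ₁ hκ₂ Ω δ Ωp LK G hΩ hδ hLK hG J hJ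
  by_cases hap : ¬ (p : ℤ) ∣ W.frobeniusTrace p
  · -- ordinary slice: PURE-CITE (ordSliceES_closed)
    exact ordSliceES_closed hIn hmodP W p hp hgood ⟨hgood, hap⟩ hs K ι v vbar κ₁ κ₂ γ₁ γ₂ N f hf hN hK hsplit hv hvbar hvv hι
      hcop hHeeg hodd hne3 hκ₁ hκ₂ Ω δ Ωp LK G hΩ hδ hLK hG J hJ
  have ha0 : W.frobeniusTrace p = 0 := (W.natCast_dvd_frobeniusTrace_iff_eq_zero p hp hgood).mp (not_not.mp hap)
  haveI : Fact (κ₂.IsTopGenerator γ₂) := ⟨YanZhu2026.isTopGenerator_of_pair (κ₁ := κ₁) (γ₁ := γ₁)⟩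
  -- (1) the inputs at `a_p = 0` (finite generation is a tree theorem, p610206)
  letI instQ : Module (IwasawaAlgebra p)
      (QuotSMulTop (PowerSeries.X : IwasawaAlgebra₂ p) ((W.baseChange K).XGr₂ p κ₁ κ₂ vbar γ₁ γ₂)) :=
    Module.compHom _ (PowerSeries.C (R := IwasawaAlgebra p))
  haveI hfg : Module.Finite (IwasawaAlgebra₂ p) ((W.baseChange K).XGr₂ p κ₁ κ₂ vbar γ₁ γ₂) :=
    Summit.BirchSwinnertonDyer.BirchSwinnertonDyer.Theorems.SignedBaseChangeAcDivFinitePiece.xGr₂_module_finite (W.baseChange K) p κ₁ κ₂ vbar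
  obtain ⟨fc, hfc⟩ := controlExactSS hIn hmodP W p hp hgood ha0 hs K ι v vbar κ₁ κ₂ γ₁ γ₂ N f hf hN hK hsplit hv hvbar hvv hι hcop hHeeg hodd hne3 hκ₁ hκ₂
  have hXt := xAcTorsionSS_closed hIn hmodP W p hp hgood ha0 hs K ι v vbar κ₁ κ₂ γ₁ γ₂ N f hf hN hK hsplit hv hvbar hvv hι hcop hHeeg hodd hne3 hκ₁ hκ₂
  obtain ⟨g, hg, hgu⟩ := xAcMuZeroSS_closed hIn hmodP W p hp hgood ha0 hs K ι v vbar κ₁ κ₂ γ₁ γ₂ N f hf hN hK hsplit hv hvbar hvv hι hcop hHeeg hodd hne3 hκ₁ hκ₂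
  obtain ⟨a, hrat⟩ := stub_ratEulerSystemSS hIn hmodP W p hp hgood ha0 hs K ι v vbar κ₁ κ₂ γ₁ γ₂ N f hf hN hK hsplit hv hvbar hvv hι hcop hHeeg hodd hne3 hκ₁ hκ₂ Ω δ Ωp LK G hΩ hδ hLK hG J hJ
  -- (2) exact control: `X_Gr₂/T₁ ≅ X_ac`, so `X_Gr₂/T₁` is `Λ₁`-torsion; a killing element `s`, `s(0) ≠ 0`
  let e := LinearEquiv.ofBijective fc hfc
  have hQt : Module.IsTorsion (IwasawaAlgebra p)
      (QuotSMulTop (PowerSeries.X : IwasawaAlgebra₂ p) ((W.baseChange K).XGr₂ p κ₁ κ₂ vbar γ₁ γ₂)) :=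
    LocalLength.isTorsion_of_injective' fc hfc.1 hXt
  obtain ⟨s, hs0, hs'⟩ :=
    S2.exists_constantCoeff_ne_zero_of_isTorsion p ((W.baseChange K).XGr₂ p κ₁ κ₂ vbar γ₁ γ₂) hQt
  -- (3) Herbrand divisibility + control: `ch(X_ac) = ch(X_Gr₂/T₁) ⊆ π(ch X_Gr₂)`
  have hle := charIdeal_quotSMulTop_le_map p ((W.baseChange K).XGr₂ p κ₁ κ₂ vbar γ₁ γ₂) ⟨s, hs0, hs'⟩
  have hQA : charIdeal (IwasawaAlgebra p)
      (QuotSMulTop (PowerSeries.X : IwasawaAlgebra₂ p) ((W.baseChange K).XGr₂ p κ₁ κ₂ vbar γ₁ γ₂)) =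
      charIdeal (IwasawaAlgebra p) (Castella2018.AcSelmer.XAc (W.baseChange K) p κ₂ vbar ∅ γ₂) :=
    LocalLength.charIdeal_eq_of_linearEquiv e
  have hspec : Castella2018.AcSelmer.XAc.charIdeal (W.baseChange K) p κ₂ vbar ∅ γ₂ ≤
      (WeierstrassCurve.XGr₂.charIdeal (W.baseChange K) p κ₁ κ₂ vbar γ₁ γ₂).map
        (PowerSeries.constantCoeff (R := IwasawaAlgebra p)) := by
    show charIdeal (IwasawaAlgebra p) (Castella2018.AcSelmer.XAc (W.baseChange K) p κ₂ vbar ∅ γ₂) ≤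
      (charIdeal (IwasawaAlgebra₂ p) ((W.baseChange K).XGr₂ p κ₁ κ₂ vbar γ₁ γ₂)).map
        (PowerSeries.constantCoeff (R := IwasawaAlgebra p))
    rw [← hQA]
    exact hle
  -- (5) base change along `J`: `π`, then `J` = `J`, then `π`
  have hmapJ : ((WeierstrassCurve.XGr₂.charIdeal (W.baseChange K) p κ₁ κ₂ vbar γ₁ γ₂).map
        (PowerSeries.constantCoeff (R := IwasawaAlgebra p))).map (PowerSeries.map J) =
      ((WeierstrassCurve.XGr₂.charIdeal (W.baseChange K) p κ₁ κ₂ vbar γ₁ γ₂).map (IwasawaAlgebra₂.toUnr₂ p J)).map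
        (PowerSeries.constantCoeff (R := PowerSeries (PadicComplexInt p))) := by
    simp only [Ideal.map_map, S2.constantCoeff_comp_toUnr₂]
  -- (6) a generator `c` of `ch(X_Gr₂)^J`; `c⁻ ∣ J(g)`, so `μ(c⁻) = 0`
  haveI : UniqueFactorizationMonoid (IwasawaAlgebra₂ p) :=
    Literature.NumberTheory.IwasawaTheory.uniqueFactorizationMonoid_iwasawaAlgebraTwoVar p
  obtain ⟨c₀, hc₀⟩ := (LocalLength.isPrincipal_charIdeal_of_ufm (R := IwasawaAlgebra₂ p)
    (M := (W.baseChange K).XGr₂ p κ₁ κ₂ vbar γ₁ γ₂)).principal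
  have hch : (WeierstrassCurve.XGr₂.charIdeal (W.baseChange K) p κ₁ κ₂ vbar γ₁ γ₂).map (IwasawaAlgebra₂.toUnr₂ p J) =
      Ideal.span {IwasawaAlgebra₂.toUnr₂ p J c₀} := by
    show (charIdeal (IwasawaAlgebra₂ p) ((W.baseChange K).XGr₂ p κ₁ κ₂ vbar γ₁ γ₂)).map _ = _
    rw [hc₀]
    show (Ideal.span {c₀}).map _ = _
    rw [Ideal.map_span, Set.image_singleton]
  have hmem : PowerSeries.map J g ∈ Ideal.span {UnrSeries₂.minus (IwasawaAlgebra₂.toUnr₂ p J c₀)} := by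
    have h1 : PowerSeries.map J g ∈
        ((WeierstrassCurve.XGr₂.charIdeal (W.baseChange K) p κ₁ κ₂ vbar γ₁ γ₂).map
          (PowerSeries.constantCoeff (R := IwasawaAlgebra p))).map (PowerSeries.map J) :=
      Ideal.mem_map_of_mem _ (hspec hg)
    rw [hmapJ, hch, Ideal.map_span, Set.image_singleton] at h1
    exact h1
  obtain ⟨h, hh⟩ := Ideal.mem_span_singleton'.mp hmem
  have hμc : GreenbergVatsal2000.HasUnitContent (UnrSeries₂.minus (IwasawaAlgebra₂.toUnr₂ p J c₀)) := by
    have hgJ : GreenbergVatsal2000.HasUnitContent (PowerSeries.map J g) := hgu.map J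
    rw [← hh] at hgJ
    exact hasUnitContent_of_mul_left hgJ
  -- (7) cancel the power of `p` in F1 against `μ(c⁻) = 0`
  rw [hch]
  refine le_span_of_span_natCast_pow_mul_le_of_hasUnitContent_minus hμc (n := a) ?_
  rw [Ideal.span_singleton_mul_span_singleton, ← hch]
  exact hrat


end Summit.BirchSwinnertonDyer.BirchSwinnertonDyer.Cruxes.TwoVariableEulerSystemDivisibility.Ratlift

end
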